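import Mathlib
import Literature.Combinatorics.Kakeya.FiniteFieldFurstenberg
import Literature.Combinatorics.Designs.DesignSubstructureBound
import Literature.Combinatorics.Designs.FisherInequality
import Literature.LinearAlgebra.Subspace.GaussianBinomialCount
import HarnessLib

/-!
# Furstenberg sets over finite fields via incidence bounds (Dhar–Dvir–Lund 2021, Theorems 2 and 3;
# Lemma 5 = Haemers' incidence bound for points and `k`-flats; Lemmas 6, 21, 22, 23)

Topic `Literature/Combinatorics/Kakeya`.  Everything in this file is PROVED (no named fact, no
`sorry`).  Companion to `FiniteFieldFurstenberg.lean` (Dhar–Dvir–Lund's Theorems 1, 4, 17–19: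
the polynomial-method / min-entropy bounds `K(q,n,k,m) ≥ m^{n/k}/2ⁿ`), which left out the part of
the paper that rests on "incidence estimates for large sets in finite fields": §2.1 (flats,
Gaussian binomials, Haemers' point–flat incidence bound, the poor-flats bound) and §7 (Lemmas
21–23, Theorems 2 and 3).  With this file every numbered result of the paper is formalised.  The
incidence bound itself is obtained from the tree's form of Haemers' theorem for `2`-designs
(`Literature.Combinatorics.Designs.DesignSubstructureBound`, Brouwer–Haemers Theorem 4.9.1 with
`θ₂² = r − λ`) applied to the `2`-design of `k`-flats of `𝔽_qⁿ`, whose parameters come from Cohn's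
subspace count (`Literature.LinearAlgebra.Subspace.GaussianBinomialCount`).

Source: M. Dhar, Z. Dvir, B. Lund, *Simple proofs for Furstenberg sets over finite fields*,
Discrete Analysis 2021:22, 16 pp. (doi:10.19086/da.29067) = arXiv:1909.03180v2 (the journal
version; read in its LaTeX source, numbering and pages of the DA PDF).  Verbatim:

> (§1, p. 3) A separate argument gives stronger bounds for large `m`. Let `S` be any set of
> `m q^{n−k}` points in `𝔽_qⁿ`. A simple pigeonholing argument shows that `S` is a
> `(k, m)`-Furstenberg set. When `m` is sufficiently large relative to `q`, it turns out that there
> are no Furstenberg sets much smaller than this trivial construction.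
>
> **Theorem 2.** Let `ε > 0`, let `q` be a prime power, and let `n, k,` and `m` be integers with
> `2 ≤ k < n` and `m ≤ q^k`. If `m ≥ 2^{n+7−k} q ε^{−2}`, then `K(q, n, k, m) ≥ (1 − ε) m q^{n−k}`.
>
> Note that, since `q^k ≥ m`, Theorem 2 never applies if `q^{k−1} < 2^{n+7−k}`.
> When `k > n/2` and `m > q^{n−k}`, we can remove the assumption that the `k`-flats
> are in different directions and still prove a stronger bound than previously known. The number
> of rank `k` subspaces in `𝔽_qⁿ` is given by the `q`-binomial coefficient `[n choose k]_q` (see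
> Section 2.1 for details).
>
> **Theorem 3.** Let `q` be a prime power, and let `n, k,` and `m` be integers with
> `n/2 < k < n` and `0 ≤ m ≤ q^k`. Let `S ⊆ 𝔽_qⁿ`. Let `L` be a set of `k`-flats that each contain
> at least `m` points of `S`, with `|L| = [n choose k]_q`. Then,
> `|S| ≥ (1 − q^{n−2k} − √(q^{n−k} m^{−1})) m q^{n−k}`.
> In particular, the same lower bound holds for `K(q, n, k, m)`.
>
> Note that, if `m < q^{n−k}`, then the right side of the inequality in Theorem 3 is negative.
> Hence Theorem 3 is interesting only for larger `m`. The proof of Theorem 2 combines (1) with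
> incidence estimates for large sets in finite fields. The proof of Theorem 3 relies only on
> incidence estimates for large sets in finite fields, and doesn't rely on the polynomial method.
>
> (§2.1, pp. 3–4) A *`k`-flat* is a translate of a rank `k` linear subspace. […] For integers
> `1 ≤ k < n`, the number of rank `k` subspaces of `𝔽_qⁿ` is given by the `q`-binomial coefficient
> `[n choose k]_q`. […] The Pascal identities for `q`-binomial coefficients are
> (7) `[n choose k]_q = q^k [n−1 choose k]_q + [n−1 choose k−1]_q`, and
> (8) `[n choose k]_q = [n−1 choose k]_q + q^{n−k} [n−1 choose k−1]_q`. […]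
> The number of `k`-flats in `𝔽_qⁿ` is `q^{n−k} [n choose k]_q`.
> A point is *incident* to a flat if the point is contained in the flat. Given a set `L` of flats,
> and a set `S` of points, both in `𝔽_qⁿ`, we denote by `I(S, L) = |{(p, ℓ) ∈ S × L : p ∈ ℓ}|` the
> number of incidences between `S` and `L`.
> The following bound on the number of incidences between points and `k`-flats was first proved
> by Haemmers [8, Chapter 3]. The exact statement used here can also be recovered from the proof
> of Theorem 1 in [10].
>
> **Lemma 5.** If `S` is a set of points and `L` a set of `k`-flats, both in `𝔽_qⁿ`, then
> `I(S, L) ≤ q^{k−n} |S| |L| + √( q^k [n−1 choose k]_q |S| |L| (1 − |S| q^{−n}) (1 − |L| q^{k−n} [n choose k]_q^{−1}) )`.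
>
> Given a set `S` of points, a flat is *`(S, t)`-rich* if it contains at least `t` points of `S`.
> A flat is *`(S, t)`-poor* if it contains fewer than `t` points of `S`. The following upper bound
> on the number of `(S, t)`-poor flats is a slight reformulation of [10, Corollary 5]. A slightly
> weaker bound was proved earlier by Alon [1].
> **Lemma 6.** Let `S ⊂ 𝔽_q^k` be a set of `m` points. Let `0 < δ < 1` and `1 ≤ ℓ ≤ k − 1`. The
> number of `(S, δ m q^{ℓ−k} + 1)`-poor `ℓ`-flats is at most
> `(1 + m q^{ℓ−k}(1 − δ)²)^{−1} q^{k−ℓ} [k choose ℓ]_q`.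
>
> (§7, pp. 11–13) **Lemma 21.** Let `F` be a set of `k`-flats in `𝔽_qⁿ`, one parallel to each
> rank `k` subspace, with `2 ≤ k < n`. Let `1 ≤ ℓ < k`. The number of `ℓ`-flats contained in the
> flats of `F` is at least `[n choose ℓ]_q K(q, n − ℓ, k − ℓ, q^{k−ℓ})`. […] For the proof of
> Theorem 2, we only need the case `ℓ = k − 1` of Lemma 21. The application of (1) to obtain an
> explicit bound on `K(q, n, 1, q)` for use with Lemma 21 is the only application in this section
> of any result proved using the polynomial method.
> **Lemma 22.** Let `2 ≤ k < n`. Let `S` be a `(k, m)`-Furstenberg set in `𝔽_qⁿ`. Let `δ < 1`. Let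
> `G_r` be the set of `(k−1)`-flats that are each incident to at least `r = δ m q^{−1} + 1` points
> of `S`. If `m ≥ 2^{n+3−k} q (1 − δ)^{−2}`, then `|G_r| > 2^{k−2−n} q^{n−k+1} [n choose k−1]_q`.
> *Proof.* Let `F` be a set of `k`-flats that each intersect `S` in at least `m` points, such
> that, for each rank `k` subspace, there exists a flat of `F` parallel to it. By Lemma 21 and the
> Kakeya bound (1), there is a set `G` of `(k−1)`-flats contained in the flats of `F` with
> `|G| ≥ K(q, n−k+1, 1, q) [n choose k−1]_q ≥ 2^{k−1−n} q^{n−k+1} [n choose k−1]_q`. Let `G_p ⊆ G`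
> be those flats of `G` that are `(S, r)`-poor. We will show that `|G_p| < 2^{−1}|G|` […] Applying
> Lemma 6, the number of `(S, r)`-poor `(k−1)`-flats contained in any given `k`-flat is at most
> `(1 + m q^{−1}(1 − δ)²)^{−1} q (1 − q^k)(1 − q)^{−1}`. Since `m ≥ 2^{n+3−k} q (1 − δ)^{−2}`, we have
> `(1 + m q^{−1}(1 − δ)²)^{−1} < 2^{k−3−n}`. Summing over the flats of `F` and using the exact
> expression (9) […] `|G_p| < 2^{k−2−n} [n choose k−1]_q q^{n−k+1} ≤ 2^{−1}|G|`.
>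
> (§7, p. 13) The next lemma is essentially a reformulation of Lemma 5.
> **Lemma 23.** Let `P ⊆ 𝔽_qⁿ` be a set of points. Let `δ, γ > 0`, and let `L` be a set of
> `ℓ`-flats that each contain at least `δ q^ℓ` points of `P`, and suppose that
> `|L| = γ q^{n−ℓ} [n choose ℓ]_q`. Let `κ = γ q^ℓ`. Then,
> `|P| ≥ (δκ(κ+1)^{−1} − √(δ(1−δ)κ^{−1})) qⁿ`.
> *Proof.* Let `ε = |P| q^{−n}`. If `δ ≤ ε`, then `|P| ≥ δ qⁿ`, which is stronger than the
> conclusion of the lemma. Hence, we may assume that `ε < δ`. Since each flat of `L` contains at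
> least `δ q^ℓ` points of `P`, it follows that `I(P, L) ≥ δ q^ℓ |L|`. By Lemma 5,
> `δ q^ℓ |L| ≤ ε q^ℓ |L| + √( q^ℓ [n−1 choose ℓ]_q |P| |L| (1 − q^{−n}|P|) )`. Rearranging,
> `(δ − ε)² q^ℓ |L| ≤ ε qⁿ (1 − ε) [n−1 choose ℓ]_q`. Since `[n choose ℓ]_q > q^ℓ [n−1 choose ℓ]_q`,
> applying the hypothesis on `|L|` gives (21) `(δ − ε)² q^ℓ γ − ε(1 − ε) < 0`. Since the
> coefficient of `ε²` in (21) is positive, `ε` must be greater than the smaller root of (21).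
> Hence, `ε > … > δκ(κ+1)^{−1} − √(δ(1−δ)κ^{−1})`.
>
> (p. 14) *Proof of Theorem 3.* Applying Lemma 23 with `δ = m q^{−k}` and `γ = q^{k−n}` yields
> `|S| ≥ m q^{n−k} (1 − (q^{2k−n} + 1)^{−1} − √((1 − mq^{−k}) q^{n−k} m^{−1}))` […] hence
> `|S| ≥ m q^{n−k} (1 − q^{n−2k} − √(q^{n−k} m^{−1}))`.
> *Proof of Theorem 2.* […] Apply Lemma 22 to `S` with `δ = 1 − ε/4`. This gives a set `G_r` of
> `(k−1)`-flats, each incident to more than `(1 − ε/4) m q^{−1}` points of `S`, with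
> `|G_r| > 2^{k−2−n} q^{n−k+1} [n choose k−1]_q`. Next apply Lemma 23 to `G_r` with
> `δ = (1 − ε/4) m q^{−k}`, `ℓ = k − 1`, and `γ = 2^{k−2−n}`. […] `κ(1 + κ)^{−1} ≥ 1 − ε² 2^{−5} > 1 − ε/4`,
> and `κ^{−1} ≤ 2^{−5} ε²`. Thus we have `|S| q^{−n} ≥ δκ(κ+1)^{−1} − √(δ(1−δ)κ^{−1}) > δ(1 − ε/4) − √δ (ε/4) > δ(1 − ε/2) = (1 − ε/4)(1 − ε/2) m q^{−k} > (1 − ε) m q^{−k}`.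

## Setting

`K` is a finite field with `q = Fintype.card K` elements, `𝔽_qⁿ = (Fin n → K)`.  Flats are
finsets of points: `translate W x = {y : y − x ∈ W}` for a subspace `W`, and
`kFlats K n k : Finset (Finset (Fin n → K))` is the set of all `k`-flats.  The Gaussian binomial
`[n choose k]_q` is the tree's `Literature.Combinatorics.Enumerative.qBinomial q n k` (an element of
`ℤ` resp. `ℝ`, defined by the `q`-Pascal rule (7)); `I(S, L)` is `incidences S L`.  Exponents
`q^{k−n}`, `q^{−n}`, `q^{n−2k}` with negative values are integer powers (`zpow`) of `(q : ℝ)`.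

## What is proved

* §2.1: `translate`, `kFlats`, `mem_translate`, `card_translate` (`|W + x| = q^{dim W}`),
  `eq_of_translate_eq` (a flat determines its direction), `card_kFlats_filter_mem_eq_qBinomial`
  (`[n choose k]_q` `k`-flats through each point, from Cohn's theorem
  `card_subspaces_fin_eq_qBinomial` of the tree), `card_subspaces_mem_eq_qBinomial`
  (`[n−1 choose k−1]_q` rank-`k` subspaces through a non-zero vector), **`isDesign_kFlats`: the
  `k`-flats form a `2-(qⁿ, q^k, [n−1 choose k−1]_q)` design** (`1 ≤ k ≤ n`), `card_kFlats_eq`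
  ("the number of `k`-flats in `𝔽_qⁿ` is `q^{n−k}[n choose k]_q`"), `qBinomial_pascal` ((7)),
  `incidences` with `incidences_eq_sum_points` / `incidences_eq_sum_flats` / `mul_card_le_incidences`.
* **`incidences_le` — Lemma 5 exactly as printed** (both correction factors), from the squared
  form `sq_incidences_sub_le`:
  `(I(S,L) − q^{k−n}|S||L|)² ≤ q^k [n−1 choose k]_q |S| (1 − |S| q^{−n}) |L| (1 − |L|/(q^{n−k}[n choose k]_q))`;
  `le_incidences` — the lower tail `I(S, L) ≥ q^{k−n}|S||L| − √(…)` given by the same estimate.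
* **`sub_sqrt_mul_pow_le_card` — Lemma 23 exactly as printed**, and
  `sub_sqrt_mul_pow_le_card_of_le` — the same with `|L| ≥ γ q^{n−ℓ}[n choose ℓ]_q` (the proof
  uses only this); `sub_sqrt_le_of_sq_mul_le` — the endgame "(21) ⇒ `ε ≥ δκ(κ+1)⁻¹ − √(δ(1−δ)κ⁻¹)`".
* **`mul_le_card_of_rich_flats` — Theorem 3 exactly as printed**, and
  **`mul_le_furstenbergNumber` — "the same lower bound holds for `K(q, n, k, m)`"** (with the
  tree's `furstenbergNumber`, `IsFurstenberg` of `FiniteFieldFurstenberg.lean`).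
* `card_mul_le_of_poor`, **`card_poor_le` — Lemma 6** (corrected threshold, see below): the
  `ℓ`-flats with at most `δ m q^{ℓ−n}` points of an `m`-set `S ⊆ 𝔽_qⁿ` number
  `≤ (1 + m q^{ℓ−n}(1−δ)²)⁻¹ q^{n−ℓ}[n choose ℓ]_q` (a Chebyshev–Cantelli consequence of the squared
  form of Lemma 5).
* **`qBinomial_mul_furstenbergNumber_le_card` — Lemma 21** (all `0 ≤ ℓ < k < n`; `direction C`, the
  span of the differences of a flat, `direction_translate`).
* `card_poor_subflats_mul_le` — Lemma 6 inside a `k`-flat (transport `Γ + y ≅ 𝔽_q^k`), the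
  per-flat step of Lemma 22; **`lt_card_rich_subflats` — Lemma 22** (with "at least
  `δ m q^{−1} + 1` points" read as "more than `δ m q^{−1}` points", see below).
* **`sub_mul_le_furstenbergNumber` — Theorem 2 exactly as printed**
  (`K(q,n,k,m) ≥ (1 − ε) m q^{n−k}` for `2 ≤ k < n`, `m ≤ q^k`, `ε > 0`, `m ≥ 2^{n+7−k} q ε^{−2}`), from
  `sub_mul_le_card_of_isFurstenberg` (the same for every `(k, m)`-Furstenberg `S`).
* Two classical specialisations of Lemma 5 (`k = n − 1`, `[n−1 choose n−1]_q = 1`):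
  `incidences_hyperplanes_le` — `I(P, H) ≤ |P||H|/q + q^{(n−1)/2} √(|P||H|)` for points and
  hyperplanes of `𝔽_qⁿ` (Vinh 2011, Theorem 5, with his `1 + o(1)` replaced by `1`), and
  **`incidences_lines_le` — Vinh's Szemerédi–Trotter type theorem (2011, Theorem 3) exactly as
  printed: `|{(p, l) ∈ P × L : p ∈ l}| ≤ |P||L|/q + q^{1/2} √(|P||L|)` for points and lines in `𝔽_q²`.**

## Proof architecture (as printed) and deviations

Lemma 5: the printed sources are Haemers' thesis [8, Ch. 3] and Lund–Saraf [10, proof of Thm 1];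
here it is the tree's Haemers bound for `2-(v, k, λ)` designs
(`DesignSubstructureBound.isDesign_sq_flags_sub_le`:
`(m′ − |S||T| r/b)² ≤ (r − λ) · |S|(v − |S|)/v · |T|(b − |T|)/b`) for the design of `k`-flats:
`v = qⁿ`, block size `q^k`, `λ = [n−1 choose k−1]_q` (rank-`k` subspaces containing `y − x`, counted
through `𝔽_qⁿ/𝔽_q(y − x)` by the tree's `card_ge_codim_eq_qBinomial`), `r = [n choose k]_q`,
`b q^k = qⁿ r` and `r − λ = q^k [n−1 choose k]_q` by (7) — which is the printed right-hand side on
the nose.  Lemma 23: followed line by line ((∗) `(δ − ε)² q^ℓ |L| ≤ ε(1−ε) qⁿ [n−1 choose ℓ]_q`,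
then `|L| ≥ γ q^{n−ℓ}[n choose ℓ]_q ≥ γ qⁿ [n−1 choose ℓ]_q + γ q^{n−ℓ}` by (7) and
`[n−1 choose ℓ−1]_q ≥ 1`, whence (21) in the non-strict form `(δ − ε)² κ ≤ ε(1 − ε)`, which
suffices); the last step ("`ε` is greater than the smaller root") is done without the root
formula: with `x = δ − ε`, `u = δ/(κ+1)`, `C = √(δ(1−δ)κ⁻¹)` and
`g(t) = (κ+1)t² − (2δ−1)t − δ(1−δ)`, (21) reads `g(x) ≤ 0`, while `g(u + C) = u(1−δ) + C + C² ≥ 0`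
and `g(x) − g(u+C) = (x − u − C)((κ+1)(x − u − C) + 2(κ+1)C + 1) > 0` if `x > u + C`; so
`x ≤ u + C`, i.e. `ε ≥ δκ(κ+1)⁻¹ − C`.  Theorem 3: Lemma 23 with `δ = m q^{−k}`, `γ = q^{k−n}`;
the two closing estimates are `κ(κ+1)⁻¹ ≥ 1 − κ⁻¹ = 1 − q^{n−2k}` and
`√((1 − m q^{−k}) q^{n−k} m^{−1}) ≤ √(q^{n−k} m^{−1})` (the printed intermediate display with
`− q^{2n−4k} + √(q^{n−2k})` is bypassed); `m = 0` is trivial.  Declared generalisations: Lemma 5 and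
Lemma 23 are stated for `1 ≤ k ≤ n` resp. `1 ≤ ℓ ≤ n` (the design needs blocks of size `≥ 2`);
`K` is any finite field (the printed `q` a prime power).

Lemma 6: the squared form of Lemma 5 for `(S, L_p)`, `L_p` a family of poor flats, is a
Chebyshev–Cantelli inequality: `I(S, L_p) ≤ δμ|L_p|` (`μ = m q^{ℓ−n}`) gives
`((1−δ)μ|L_p|)² ≤ q^ℓ[n−1 choose ℓ]_q m |L_p|(1 − |L_p|/b)`, and with
`[n choose ℓ]_q ≥ q^ℓ[n−1 choose ℓ]_q` this is `|L_p|(1 + μ(1−δ)²) ≤ b = q^{n−ℓ}[n choose ℓ]_q`.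
**CORRECTION (Lemma 6, and accordingly Lemma 22), declared:** "`(S, δ m q^{ℓ−k} + 1)`-poor"
(fewer than `δ m q^{ℓ−k} + 1` points) is formalised as "at most `δ m q^{ℓ−k}` points"; the two
agree when `δ m q^{ℓ−k} ∈ ℤ`, and for non-integral `δ m q^{ℓ−k}` the printed bound fails (all
`q² + q` lines of `𝔽_q²` are `(S, δq + 1)`-poor for `S = 𝔽_q²`, `δ = 1 − 1/(2q)`, but
`(1 + q(1−δ)²)^{−1}(q² + q) < q² + q`); the proof of Theorem 2 only ever uses flats with MORE than
`δ m q^{−1}` points, which is what the corrected Lemma 22 provides.  Lemma 6 is proved with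
ambient `𝔽_qⁿ` (printed `𝔽_q^k`), for `1 ≤ ℓ ≤ n` and any `δ ≤ 1`.
Lemma 21: as printed, except that the complement `P_Λ` (`Λ ∩ P_Λ = 0`, `Λ + P_Λ = 𝔽_qⁿ`) is
replaced by the quotient map `π : 𝔽_qⁿ → 𝔽_q^{n−ℓ}` with `ker π = Λ` (the tree's
`exists_linearMap_ker_eq`), to which `P_Λ` is canonically isomorphic: `K_Λ = {π x : Λ + x ⊆ some
flat of F}` is `(k−ℓ, q^{k−ℓ})`-Furstenberg (`g(Γ) = π(Γ)`, `g⁻¹(H) = π⁻¹(H)`), and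
`z ↦ Λ + π⁻¹(z)` injects `K_Λ` into the `ℓ`-flats of direction `Λ` inside flats of `F`; the lemma
holds (and is proved) for all `0 ≤ ℓ < k < n`, and "one parallel to each rank `k` subspace" is used
only as "some flat of `F` parallel to each".  Lemma 22: as printed (with the corrected notion of
poor); Lemma 6 is applied inside each flat `Γ + y ∈ F` after transporting `Γ + y ≅ 𝔽_q^k` along
`z ↦ y + ψ(z)`, `ψ : 𝔽_q^k ≅ Γ` linear (`card_poor_subflats_mul_le`; a flat with `m′ ≥ m` points of
`S` and `δ′ = δ m/m′` has `m′(1−δ′)² ≥ m(1−δ)²`); the exact expression (9) enters as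
`(1 − q^k)[n choose k]_q = (1 − q^{n−k+1})[n choose k−1]_q` (the tree's `qBinomial_key`) and
`[k choose k−1]_q (q − 1) = q^k − 1`.  Theorem 2: as printed up to the last display, where —
**REPAIR, declared** — "`√(δ(1−δ)κ^{−1}) < √δ (ε/4)`" would not give "`> δ(1 − ε/2)`" (`√δ ≥ δ`
for `δ ≤ 1`); instead `δκ = (1 − ε/4) m 2^{k−2−n} q^{−1} ≥ 24 ε^{−2}` (from the same hypothesis
`m ≥ 2^{n+7−k} q ε^{−2}`) gives `√(δ(1−δ)κ^{−1}) ≤ δ/√(δκ) ≤ δ ε/4`, and the printed conclusion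
`|S| q^{−n} ≥ δ(1 − ε/2) = (1 − ε/4)(1 − ε/2) m q^{−k} > (1 − ε) m q^{−k}` follows; `ε ≥ 1` is trivial.

## Not in this file

The spectral proofs of [8], [10] (interlacing / eigenvalues of the point–flat incidence graph) —
the tree's design bound is the Cauchy–Schwarz ("expander mixing") form of Haemers' theorem;
equation (6) (dimension of a span) and the closed formula (9) as such; Lemma 6 / Lemma 22 with the
literal threshold "`δ m q^{ℓ−k} + 1`" for non-integral `δ m q^{ℓ−k}` (false resp. unproved as
printed, see above).

## References
* [DharDvirLund2021FurstenbergFiniteFields] M. Dhar, Z. Dvir, B. Lund, Discrete Analysis 2021:22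
  (doi:10.19086/da.29067; arXiv:1909.03180v2) — §1 Theorems 2, 3 (p. 3), §2.1 (pp. 3–4: flats,
  `[n choose k]_q`, (7), (8), (9), the number of `k`-flats, `I(S, L)`, Lemmas 5, 6), §7 Lemma 21
  (pp. 11–12), Lemma 22 (pp. 12–13), Lemma 23 (p. 13, proof pp. 13–14), proofs of Theorems 3 and 2
  (p. 14).  (arXiv v1 states Lemma 5 without the two correction factors and Theorem 3 with
  `q^{n−k} < m`; the journal text is followed here.)
* N. Alon, *Eigenvalues, geometric expanders, sorting in rounds, and Ramsey theory*,
  Combinatorica 6 (1986) 207–219 — cited through the source as [1] (Lemma 6).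
* [Vinh2011] L. A. Vinh, *The Szemerédi–Trotter type theorem and the sum-product estimate in finite
  fields*, European J. Combin. 32 (2011) 1177–1181, doi:10.1016/j.ejc.2011.06.008 = arXiv:0711.4427
  (read in the corpus text `paper:arxiv-0711.4427`: Theorem 3 with its proof (§2, the
  `(q+1)`-regular Erdős–Rényi graph, `A² = J + qI`, the expander mixing lemma), Theorem 5).
* W. H. Haemers, *Eigenvalue techniques in design and graph theory*, Math. Centre Tracts 121
  (Amsterdam, 1980), Ch. 3 — cited through the source as [8]; in the tree through
  A. E. Brouwer, W. H. Haemers, *Spectra of Graphs* (2012), Thm 4.9.1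
  (`Literature.Combinatorics.Designs.DesignSubstructureBound`, bib key of that file).
* B. Lund, S. Saraf, *Incidence bounds for block designs*, SIAM J. Discrete Math. 30 (2016),
  1997–2010 — cited through the source as [10].
* H. Cohn, *Projective geometry over `𝔽₁` and the Gaussian binomial coefficients*, Amer. Math.
  Monthly 111 (2004) — the subspace count, through `Literature.LinearAlgebra.Subspace.GaussianBinomialCount`.
-/

namespace Literature.Combinatorics.Kakeya

namespace Furstenberg

open Finset Module
open Literature.Combinatorics.Enumerative (qBinomial qBinomial_succ_succ qBinomial_zero_right
  qBinomial_zero_succ qBinomial_eq_zero_of_lt qBinomial_self)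
open Literature.Combinatorics.Designs (Design.IsDesign)
open Literature.LinearAlgebra.Subspace (card_subspaces_fin_eq_qBinomial card_ge_codim_eq_qBinomial
  qBinomial_symm)

variable {K : Type*} [Field K]

/-! ### §2.1: flats -/

section Flats

variable {n : ℕ} [Fintype K]

/-- The translate `W + x = {y : y − x ∈ W}` of a subspace `W ≤ 𝔽_qⁿ`, as a finset of points ("A
`k`-flat is a translate of a rank `k` linear subspace", §2.1).
[cite: DharDvirLund2021FurstenbergFiniteFields, §2.1 (p. 4)] -/
noncomputable def translate (W : Submodule K (Fin n → K)) (x : Fin n → K) : Finset (Fin n → K) := by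
  classical exact univ.filter fun y => y - x ∈ W

/-- Membership in a translate. [cite: DharDvirLund2021FurstenbergFiniteFields, §2.1 (p. 4)] -/
theorem mem_translate {W : Submodule K (Fin n → K)} {x y : Fin n → K} :
    y ∈ translate W x ↔ y - x ∈ W := by
  classical
  simp [translate]

/-- `x ∈ W + x`. [cite: DharDvirLund2021FurstenbergFiniteFields, §2.1 (p. 4)] -/
theorem self_mem_translate (W : Submodule K (Fin n → K)) (x : Fin n → K) : x ∈ translate W x := by
  rw [mem_translate, sub_self]
  exact W.zero_mem

/-- A translate of `W` through `y ∈ W + x` is `W + x` itself.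
[cite: DharDvirLund2021FurstenbergFiniteFields, §2.1 (p. 4)] -/
theorem translate_eq_translate_of_mem {W : Submodule K (Fin n → K)} {x y : Fin n → K}
    (h : y - x ∈ W) : translate W y = translate W x := by
  ext z
  simp only [mem_translate]
  constructor
  · intro hz
    have := W.add_mem hz h
    rwa [sub_add_sub_cancel] at this
  · intro hz
    have := W.sub_mem hz h
    rwa [sub_sub_sub_cancel_right] at this

/-- The direction of a flat is determined by the flat: if `W + x = W′ + x′` then `W ≤ W′`.
[cite: DharDvirLund2021FurstenbergFiniteFields, §2.1 (p. 4)] -/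
theorem le_of_translate_eq {W W' : Submodule K (Fin n → K)} {x x' : Fin n → K}
    (h : translate W x = translate W' x') : W ≤ W' := by
  intro w hw
  have hx : x ∈ translate W' x' := h ▸ self_mem_translate W x
  have hxw : x + w ∈ translate W' x' := by
    rw [← h, mem_translate, add_sub_cancel_left]
    exact hw
  rw [mem_translate] at hx hxw
  have := W'.sub_mem hxw hx
  rwa [sub_sub_sub_cancel_right, add_sub_cancel_left] at this

/-- The direction of a flat is determined by the flat.
[cite: DharDvirLund2021FurstenbergFiniteFields, §2.1 (p. 4)] -/
theorem eq_of_translate_eq {W W' : Submodule K (Fin n → K)} {x x' : Fin n → K}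
    (h : translate W x = translate W' x') : W = W' :=
  le_antisymm (le_of_translate_eq h) (le_of_translate_eq h.symm)

/-- A translate of `W` has `q^{dim W}` points. [cite: DharDvirLund2021FurstenbergFiniteFields, §2.1 (p. 4)] -/
theorem card_translate (W : Submodule K (Fin n → K)) (x : Fin n → K) :
    #(translate W x) = Fintype.card K ^ finrank K W := by
  classical
  have h1 : #(translate W x) = #(univ.filter fun y : Fin n → K => y ∈ W) := by
    refine Finset.card_bij (fun y _ => y - x) (fun y hy => ?_) (fun y₁ _ y₂ _ h => ?_)
      (fun z hz => ?_)
    · rw [mem_translate] at hy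
      simpa using hy
    · exact sub_left_injective h
    · refine ⟨z + x, ?_, by simp⟩
      rw [mem_translate, add_sub_cancel_right]
      simpa using hz
  rw [h1, ← Fintype.card_of_subtype (p := fun y : Fin n → K => y ∈ W)
    (univ.filter fun y : Fin n → K => y ∈ W) (fun y => by simp)]
  exact Module.card_eq_pow_finrank (K := K) (V := W)

/-- **The `k`-flats of `𝔽_qⁿ`**: the translates of the rank-`k` subspaces (§2.1: "A `k`-flat is a
translate of a rank `k` linear subspace"). [cite: DharDvirLund2021FurstenbergFiniteFields, §2.1 (p. 4)] -/
noncomputable def kFlats (K : Type*) [Field K] [Fintype K] (n k : ℕ) :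
    Finset (Finset (Fin n → K)) := by
  classical exact univ.filter fun B => ∃ W : Submodule K (Fin n → K), finrank K W = k ∧
    ∃ x : Fin n → K, B = translate W x

/-- Membership in `kFlats`. [cite: DharDvirLund2021FurstenbergFiniteFields, §2.1 (p. 4)] -/
theorem mem_kFlats {k : ℕ} {B : Finset (Fin n → K)} :
    B ∈ kFlats K n k ↔ ∃ W : Submodule K (Fin n → K), finrank K W = k ∧
      ∃ x : Fin n → K, B = translate W x := by
  classical
  simp only [kFlats, mem_filter, mem_univ, true_and]

/-- `W + x` is a `k`-flat when `dim W = k`. [cite: DharDvirLund2021FurstenbergFiniteFields, §2.1 (p. 4)] -/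
theorem translate_mem_kFlats {k : ℕ} {W : Submodule K (Fin n → K)} (hW : finrank K W = k)
    (x : Fin n → K) : translate W x ∈ kFlats K n k :=
  mem_kFlats.2 ⟨W, hW, x, rfl⟩

/-- A `k`-flat has `q^k` points. [cite: DharDvirLund2021FurstenbergFiniteFields, §2.1 (p. 4)] -/
theorem card_of_mem_kFlats {k : ℕ} {B : Finset (Fin n → K)} (hB : B ∈ kFlats K n k) :
    #B = Fintype.card K ^ k := by
  obtain ⟨W, hW, x, rfl⟩ := mem_kFlats.1 hB
  rw [card_translate, hW]

variable [DecidableEq K]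

/-- The `k`-flats through a point `x₀` are the `W + x₀`, `dim W = k`, each exactly once.
[cite: DharDvirLund2021FurstenbergFiniteFields, §2.1 (p. 4)] -/
theorem kFlats_filter_mem_eq_image (k : ℕ) (x₀ : Fin n → K) :
    (kFlats K n k).filter (fun B => x₀ ∈ B) =
      (univ : Finset {W : Submodule K (Fin n → K) // finrank K W = k}).image
        fun W => translate W.1 x₀ := by
  ext B
  simp only [mem_filter, mem_kFlats, mem_image, mem_univ, true_and]
  constructor
  · rintro ⟨⟨W, hW, x, rfl⟩, hx₀⟩
    exact ⟨⟨W, hW⟩, (translate_eq_translate_of_mem (mem_translate.1 hx₀))⟩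
  · rintro ⟨W, rfl⟩
    exact ⟨⟨W.1, W.2, x₀, rfl⟩, self_mem_translate _ _⟩

/-- The number of `k`-flats through a point is the number of rank-`k` subspaces.
[cite: DharDvirLund2021FurstenbergFiniteFields, §2.1 (p. 4)] -/
theorem card_kFlats_filter_mem (k : ℕ) (x₀ : Fin n → K) :
    #((kFlats K n k).filter fun B => x₀ ∈ B) =
      Fintype.card {W : Submodule K (Fin n → K) // finrank K W = k} := by
  rw [kFlats_filter_mem_eq_image, card_image_of_injective _ fun W W' h =>
    Subtype.ext (eq_of_translate_eq h), card_univ]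

/-- The `k`-flats through two distinct points `x ≠ y` are the `W + x` with `dim W = k` and
`y − x ∈ W`, each exactly once; so their number is the number of rank-`k` subspaces containing
`y − x`. [cite: DharDvirLund2021FurstenbergFiniteFields, §2.1 (p. 4)] -/
theorem card_kFlats_filter_pair (k : ℕ) (x y : Fin n → K) :
    #((kFlats K n k).filter fun B => {x, y} ⊆ B) =
      Nat.card {W : Submodule K (Fin n → K) // finrank K W = k ∧ y - x ∈ W} := by
  classical
  have himg : (kFlats K n k).filter (fun B => {x, y} ⊆ B) =
      (univ : Finset {W : Submodule K (Fin n → K) // finrank K W = k ∧ y - x ∈ W}).image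
        fun W => translate W.1 x := by
    ext B
    simp only [mem_filter, mem_kFlats, mem_image, mem_univ, true_and, insert_subset_iff,
      singleton_subset_iff]
    constructor
    · rintro ⟨⟨W, hW, z, rfl⟩, hx, hy⟩
      have hB := translate_eq_translate_of_mem (mem_translate.1 hx)
      refine ⟨⟨W, hW, ?_⟩, hB⟩
      rw [← hB] at hy
      exact mem_translate.1 hy
    · rintro ⟨W, rfl⟩
      exact ⟨⟨W.1, W.2.1, x, rfl⟩, self_mem_translate _ _, mem_translate.2 W.2.2⟩
  rw [himg, card_image_of_injective _ fun W W' h => Subtype.ext (eq_of_translate_eq h), card_univ,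
    Nat.card_eq_fintype_card]

end Flats

/-! ### §2.1: the Gaussian binomial counts -/

section Counts

variable {n : ℕ} [Fintype K] [DecidableEq K]

omit [DecidableEq K] in
/-- "the number of rank `k` subspaces of `𝔽_qⁿ` is given by the `q`-binomial coefficient
`[n choose k]_q`" (Cohn's theorem, from the tree). [cite: DharDvirLund2021FurstenbergFiniteFields, §2.1 (p. 4)] -/
theorem card_subspaces_eq_qBinomial (n k : ℕ) :
    (Fintype.card {W : Submodule K (Fin n → K) // finrank K W = k} : ℤ) =
      qBinomial (Fintype.card K : ℤ) n k := by
  rw [← Nat.card_eq_fintype_card, ← Nat.card_eq_fintype_card]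
  exact card_subspaces_fin_eq_qBinomial n k

omit [DecidableEq K] in
/-- The rank-`k` subspaces containing a fixed non-zero vector `v` number `[n−1 choose k−1]_q`
(`1 ≤ k ≤ n`; they correspond to the rank-`(k−1)` subspaces of `𝔽_qⁿ/𝔽_q v`).
[cite: DharDvirLund2021FurstenbergFiniteFields, §2.1 (p. 4)] -/
theorem card_subspaces_mem_eq_qBinomial {k : ℕ} (hk : 1 ≤ k) (hkn : k ≤ n) {v : Fin n → K}
    (hv : v ≠ 0) :
    (Nat.card {W : Submodule K (Fin n → K) // finrank K W = k ∧ v ∈ W} : ℤ) =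
      qBinomial (Fintype.card K : ℤ) (n - 1) (k - 1) := by
  have h := card_ge_codim_eq_qBinomial (K ∙ v) (n - k)
  rw [finrank_fin_fun, finrank_span_singleton hv, Nat.card_eq_fintype_card (α := K)] at h
  have hsymm := qBinomial_symm (Fintype.card K : ℤ) (show n - k ≤ n - 1 by omega)
  rw [show n - 1 - (n - k) = k - 1 by omega] at hsymm
  rw [hsymm, ← h]
  congr 1
  refine Nat.card_congr (Equiv.subtypeEquivRight fun W => ?_)
  rw [Submodule.span_singleton_le_iff_mem]
  constructor
  · rintro ⟨h1, h2⟩; exact ⟨h2, by omega⟩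
  · rintro ⟨h1, h2⟩; exact ⟨by omega, h1⟩

/-- The value `λ = [n−1 choose k−1]_q` as a natural number. [folklore] -/
private theorem toNat_qBinomial_cast (q a b : ℕ) :
    ((qBinomial (q : ℤ) a b).toNat : ℤ) = qBinomial (q : ℤ) a b := by
  -- `qBinomial (q : ℤ) a b` is a natural number: it is `≥ 0` by the Pascal recursion
  have hnn : ∀ a b : ℕ, 0 ≤ qBinomial (q : ℤ) a b := by
    intro a
    induction a with
    | zero => intro b; cases b <;> simp
    | succ a ih =>
      intro b
      cases b with
      | zero => simp
      | succ b =>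
        rw [qBinomial_succ_succ]
        exact add_nonneg (mul_nonneg (pow_nonneg (Int.natCast_nonneg q) _) (ih (b + 1))) (ih b)
  exact Int.toNat_of_nonneg (hnn a b)

/-- **The `k`-flats of `𝔽_qⁿ` form a `2-(qⁿ, q^k, [n−1 choose k−1]_q)` design** (`1 ≤ k ≤ n`):
every flat has `q^k` points and two distinct points lie on exactly `[n−1 choose k−1]_q` common
`k`-flats. [cite: DharDvirLund2021FurstenbergFiniteFields, §2.1 (p. 4)] -/
theorem isDesign_kFlats {k : ℕ} (hk : 1 ≤ k) (hkn : k ≤ n) :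
    Design.IsDesign 2 (Fintype.card K ^ k)
      (qBinomial (Fintype.card K : ℤ) (n - 1) (k - 1)).toNat (kFlats K n k) := by
  refine ⟨fun B hB => card_of_mem_kFlats hB, fun T hT => ?_⟩
  obtain ⟨x, y, hxy, rfl⟩ := card_eq_two.1 hT
  rw [card_kFlats_filter_pair]
  have h := card_subspaces_mem_eq_qBinomial hk hkn (sub_ne_zero.2 hxy.symm)
  have h2 := toNat_qBinomial_cast (Fintype.card K) (n - 1) (k - 1)
  omega

/-- The replication number of the design of `k`-flats: `[n choose k]_q` flats through each point.
[cite: DharDvirLund2021FurstenbergFiniteFields, §2.1 (p. 4)] -/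
theorem card_kFlats_filter_mem_eq_qBinomial (k : ℕ) (x₀ : Fin n → K) :
    (#((kFlats K n k).filter fun B => x₀ ∈ B) : ℤ) = qBinomial (Fintype.card K : ℤ) n k := by
  rw [card_kFlats_filter_mem, card_subspaces_eq_qBinomial]

/-- "The number of `k`-flats in `𝔽_qⁿ` is `q^{n−k} [n choose k]_q`" (`k ≤ n`), in the form
`#flats · q^k = qⁿ · [n choose k]_q`. [cite: DharDvirLund2021FurstenbergFiniteFields, §2.1 (p. 4)] -/
theorem card_kFlats_mul_pow {k : ℕ} (hk : 1 ≤ k) (hkn : k ≤ n) :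
    (#(kFlats K n k) : ℤ) * (Fintype.card K : ℤ) ^ k =
      (Fintype.card K : ℤ) ^ n * qBinomial (Fintype.card K : ℤ) n k := by
  have hq : 2 ≤ Fintype.card K ^ k := by
    calc 2 ≤ Fintype.card K := Fintype.one_lt_card
      _ = Fintype.card K ^ 1 := (pow_one _).symm
      _ ≤ Fintype.card K ^ k := Nat.pow_le_pow_right Fintype.card_pos hk
  have h := Literature.Combinatorics.Designs.Design.card_blocks_mul_k (isDesign_kFlats hk hkn)
    (0 : Fin n → K) hq
  rw [Fintype.card_fun, Fintype.card_fin] at h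
  rw [← card_kFlats_filter_mem_eq_qBinomial k (0 : Fin n → K)]
  exact_mod_cast h

end Counts

/-! ### §2.1: incidences; Lemma 5 (Haemers' bound for points and `k`-flats) -/

section Incidences

/-- **`I(S, L)`**, the number of incidences between a set of points `S` and a set of flats `L`:
"`I(S, L) = |{(p, ℓ) ∈ S × L : p ∈ ℓ}|`" (§2.1). [cite: DharDvirLund2021FurstenbergFiniteFields, §2.1 (p. 4)] -/
def incidences {α : Type*} [DecidableEq α] (S : Finset α) (L : Finset (Finset α)) : ℕ :=
  #((S ×ˢ L).filter fun p => p.1 ∈ p.2)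

/-- `I(S, L) = Σ_{x ∈ S} #{ℓ ∈ L : x ∈ ℓ}`. [cite: DharDvirLund2021FurstenbergFiniteFields, §2.1 (p. 4)] -/
theorem incidences_eq_sum_points {α : Type*} [DecidableEq α] (S : Finset α) (L : Finset (Finset α)) :
    incidences S L = ∑ x ∈ S, #(L.filter fun ℓ => x ∈ ℓ) := by
  unfold incidences
  rw [card_filter, sum_product]
  exact sum_congr rfl fun x _ => (card_filter _ _).symm

/-- `I(S, L) = Σ_{ℓ ∈ L} |S ∩ ℓ|`. [cite: DharDvirLund2021FurstenbergFiniteFields, §2.1 (p. 4)] -/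
theorem incidences_eq_sum_flats {α : Type*} [DecidableEq α] (S : Finset α) (L : Finset (Finset α)) :
    incidences S L = ∑ ℓ ∈ L, #(S.filter fun x => x ∈ ℓ) := by
  unfold incidences
  rw [card_filter, sum_product_right]
  exact sum_congr rfl fun ℓ _ => (card_filter _ _).symm

/-- If every flat of `L` contains at least `m` points of `S` then `I(S, L) ≥ m |L|`.
[cite: DharDvirLund2021FurstenbergFiniteFields, §2.1 (p. 4)] -/
theorem mul_card_le_incidences {α : Type*} [DecidableEq α] {S : Finset α} {L : Finset (Finset α)}
    {m : ℕ} (h : ∀ ℓ ∈ L, m ≤ #(S.filter fun x => x ∈ ℓ)) : m * #L ≤ incidences S L := by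
  rw [incidences_eq_sum_flats, mul_comm, ← smul_eq_mul, ← sum_const]
  exact sum_le_sum h

variable {n : ℕ} [Fintype K] [DecidableEq K]

/-- Ring maps commute with the Gaussian binomial (here: the cast `ℤ → ℝ`). [folklore] -/
private theorem cast_qBinomial (q : ℤ) :
    ∀ L k : ℕ, ((qBinomial q L k : ℤ) : ℝ) = qBinomial (q : ℝ) L k
  | L, 0 => by simp
  | 0, k + 1 => by simp
  | L + 1, k + 1 => by
    rw [qBinomial_succ_succ, qBinomial_succ_succ]
    push_cast
    rw [cast_qBinomial q L (k + 1), cast_qBinomial q L k]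

/-- The Gaussian binomial is non-negative for `q ≥ 0`. [folklore] -/
private theorem qBinomial_nonneg {q : ℝ} (hq : 0 ≤ q) : ∀ L k : ℕ, 0 ≤ qBinomial q L k
  | L, 0 => by simp
  | 0, k + 1 => by simp
  | L + 1, k + 1 => by
    rw [qBinomial_succ_succ]
    exact add_nonneg (mul_nonneg (pow_nonneg hq _) (qBinomial_nonneg hq L (k + 1)))
      (qBinomial_nonneg hq L k)

/-- `[L choose k]_q ≥ 1` for `k ≤ L` and `q ≥ 0`. [folklore] -/
private theorem one_le_qBinomial {q : ℝ} (hq : 0 ≤ q) : ∀ {L k : ℕ}, k ≤ L → 1 ≤ qBinomial q L k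
  | L, 0, _ => by simp
  | 0, k + 1, h => by omega
  | L + 1, k + 1, h => by
    rw [qBinomial_succ_succ]
    have h1 := one_le_qBinomial hq (show k ≤ L by omega)
    have h2 := mul_nonneg (pow_nonneg hq (k + 1)) (qBinomial_nonneg hq L (k + 1))
    linarith

/-- The replication number over `ℝ`: `[n choose k]_q` `k`-flats through each point.
[cite: DharDvirLund2021FurstenbergFiniteFields, §2.1 (p. 4)] -/
theorem card_kFlats_filter_mem_eq_qBinomial_real (k : ℕ) (x₀ : Fin n → K) :
    (#((kFlats K n k).filter fun B => x₀ ∈ B) : ℝ) = qBinomial (Fintype.card K : ℝ) n k := by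
  have h := card_kFlats_filter_mem_eq_qBinomial k x₀ (K := K)
  have h2 := cast_qBinomial (Fintype.card K : ℤ) n k
  push_cast at h2
  rw [← h2]
  exact_mod_cast h

/-- "The number of `k`-flats in `𝔽_qⁿ` is `q^{n−k} [n choose k]_q`" (`1 ≤ k ≤ n`).
[cite: DharDvirLund2021FurstenbergFiniteFields, §2.1 (p. 4)] -/
theorem card_kFlats_eq {k : ℕ} (hk : 1 ≤ k) (hkn : k ≤ n) :
    (#(kFlats K n k) : ℝ) = (Fintype.card K : ℝ) ^ (n - k) * qBinomial (Fintype.card K : ℝ) n k := by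
  have h := card_kFlats_mul_pow hk hkn (K := K)
  have h2 := cast_qBinomial (Fintype.card K : ℤ) n k
  push_cast at h2
  have h3 : (#(kFlats K n k) : ℝ) * (Fintype.card K : ℝ) ^ k =
      (Fintype.card K : ℝ) ^ n * qBinomial (Fintype.card K : ℝ) n k := by
    rw [← h2]; exact_mod_cast h
  have hq : (Fintype.card K : ℝ) ≠ 0 := Nat.cast_ne_zero.2 Fintype.card_ne_zero
  have hsplit : (Fintype.card K : ℝ) ^ n = (Fintype.card K : ℝ) ^ (n - k) * (Fintype.card K : ℝ) ^ k := by
    rw [← pow_add, Nat.sub_add_cancel hkn]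
  rw [hsplit] at h3
  have hqk : (Fintype.card K : ℝ) ^ k ≠ 0 := pow_ne_zero _ hq
  calc (#(kFlats K n k) : ℝ) = #(kFlats K n k) * (Fintype.card K : ℝ) ^ k / (Fintype.card K : ℝ) ^ k := by
        field_simp
    _ = _ := by rw [h3]; field_simp

/-- The first `q`-Pascal identity (§2.1 (7)): `[n choose k]_q = q^k [n−1 choose k]_q + [n−1 choose k−1]_q`
(`1 ≤ k`, `1 ≤ n`). [cite: DharDvirLund2021FurstenbergFiniteFields, §2.1 eq. (7) (p. 4)] -/
theorem qBinomial_pascal (q : ℝ) {n k : ℕ} (hn : 1 ≤ n) (hk : 1 ≤ k) :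
    qBinomial q n k = q ^ k * qBinomial q (n - 1) k + qBinomial q (n - 1) (k - 1) := by
  obtain ⟨n', rfl⟩ := Nat.exists_eq_add_of_le' hn
  obtain ⟨k', rfl⟩ := Nat.exists_eq_add_of_le' hk
  simp only [Nat.add_sub_cancel]
  exact qBinomial_succ_succ q n' k'

/-- **Lemma 5 (Haemers), squared "mixing" form.** For a set `S` of points and a set `L` of
`k`-flats in `𝔽_qⁿ` (`1 ≤ k ≤ n`):
`(I(S,L) − q^{k−n}|S||L|)² ≤ q^k [n−1 choose k]_q |S||L| (1 − |S| q^{−n}) (1 − |L| q^{k−n} [n choose k]_q^{−1})`.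
Proof: the `k`-flats form a `2-(qⁿ, q^k, [n−1 choose k−1]_q)` design with `r = [n choose k]_q`,
`b = q^{n−k}[n choose k]_q` and `r − λ = q^k [n−1 choose k]_q` (Pascal), and the tree's form of
Haemers' theorem for `2`-designs (`DesignSubstructureBound.isDesign_sq_flags_sub_le`, Brouwer–Haemers
Thm 4.9.1 with `θ₂² = r − λ`) is exactly this inequality.
[cite: DharDvirLund2021FurstenbergFiniteFields, Lemma 5 (p. 4)] -/
theorem sq_incidences_sub_le {k : ℕ} (hk : 1 ≤ k) (hkn : k ≤ n) (S : Finset (Fin n → K))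
    {L : Finset (Finset (Fin n → K))} (hL : L ⊆ kFlats K n k) :
    ((incidences S L : ℝ) - (Fintype.card K : ℝ) ^ k / (Fintype.card K : ℝ) ^ n * #S * #L) ^ 2 ≤
      (Fintype.card K : ℝ) ^ k * qBinomial (Fintype.card K : ℝ) (n - 1) k *
        (#S * (1 - #S / (Fintype.card K : ℝ) ^ n)) *
        (#L * (1 - #L / ((Fintype.card K : ℝ) ^ (n - k) * qBinomial (Fintype.card K : ℝ) n k))) := by
  set qR : ℝ := (Fintype.card K : ℝ) with hqR
  have hq0 : qR ≠ 0 := Nat.cast_ne_zero.2 Fintype.card_ne_zero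
  have hq2 : 2 ≤ Fintype.card K ^ k := by
    calc 2 ≤ Fintype.card K := Fintype.one_lt_card
      _ = Fintype.card K ^ 1 := (pow_one _).symm
      _ ≤ Fintype.card K ^ k := Nat.pow_le_pow_right Fintype.card_pos hk
  have hD := isDesign_kFlats hk hkn (K := K) (n := n)
  have h := Literature.Combinatorics.Designs.DesignSubstructureBound.isDesign_sq_flags_sub_le hD hq2 (0 : Fin n → K) S L hL
  have e1 : (∑ x ∈ S, (#(L.filter fun ℓ => x ∈ ℓ) : ℝ)) = incidences S L := by
    rw [incidences_eq_sum_points]; push_cast; rfl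
  have e2 := card_kFlats_filter_mem_eq_qBinomial_real k (0 : Fin n → K) (K := K)
  have e3 := card_kFlats_eq hk hkn (K := K) (n := n)
  have e4 : (Fintype.card (Fin n → K) : ℝ) = qR ^ n := by
    rw [Fintype.card_fun, Fintype.card_fin]; push_cast; rfl
  have e5 : (((qBinomial (Fintype.card K : ℤ) (n - 1) (k - 1)).toNat : ℕ) : ℝ) =
      qBinomial qR (n - 1) (k - 1) := by
    have h5 := toNat_qBinomial_cast (Fintype.card K) (n - 1) (k - 1)
    have h6 := cast_qBinomial (Fintype.card K : ℤ) (n - 1) (k - 1)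
    push_cast at h6
    rw [← h6]; exact_mod_cast h5
  rw [e1, e2, e3, e4, e5] at h
  have hB1 : 1 ≤ qBinomial qR n k := one_le_qBinomial (Nat.cast_nonneg _) hkn
  have hB0 : qBinomial qR n k ≠ 0 := (lt_of_lt_of_le one_pos hB1).ne'
  have hsplit : qR ^ n = qR ^ (n - k) * qR ^ k := by rw [← pow_add, Nat.sub_add_cancel hkn]
  have hpas := qBinomial_pascal qR (le_trans hk hkn) hk
  have eL : (incidences S L : ℝ) - qR ^ k / qR ^ n * #S * #L =
      (incidences S L : ℝ) - #S * #L * qBinomial qR n k / (qR ^ (n - k) * qBinomial qR n k) := by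
    rw [hsplit]; field_simp
  have hdiff : qBinomial qR n k - qBinomial qR (n - 1) (k - 1) = qR ^ k * qBinomial qR (n - 1) k := by
    rw [hpas]; ring
  have eR : qR ^ k * qBinomial qR (n - 1) k * (#S * (1 - #S / qR ^ n)) *
        (#L * (1 - #L / (qR ^ (n - k) * qBinomial qR n k))) =
      (qBinomial qR n k - qBinomial qR (n - 1) (k - 1)) * (#S * (qR ^ n - #S) / qR ^ n) *
        (#L * (qR ^ (n - k) * qBinomial qR n k - #L) / (qR ^ (n - k) * qBinomial qR n k)) := by
    rw [hdiff]; field_simp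
  rw [eL, eR]; exact h

/-- **Lemma 5 (Haemers' incidence bound), exactly as printed.** "If `S` is a set of points and `L`
a set of `k`-flats, both in `𝔽_qⁿ`, then
`I(S, L) ≤ q^{k−n} |S| |L| + √( q^k [n−1 choose k]_q |S| |L| (1 − |S| q^{−n}) (1 − |L| q^{k−n} [n choose k]_q^{−1}) )`."
("first proved by Haemmers [8, Chapter 3]. The exact statement used here can also be recovered
from the proof of Theorem 1 in [10]" (Lund–Saraf).)  Here `1 ≤ k ≤ n`.
[cite: DharDvirLund2021FurstenbergFiniteFields, Lemma 5 (p. 4)] -/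
theorem incidences_le {k : ℕ} (hk : 1 ≤ k) (hkn : k ≤ n) (S : Finset (Fin n → K))
    {L : Finset (Finset (Fin n → K))} (hL : L ⊆ kFlats K n k) :
    (incidences S L : ℝ) ≤ (Fintype.card K : ℝ) ^ ((k : ℤ) - n) * #S * #L +
      Real.sqrt ((Fintype.card K : ℝ) ^ k * qBinomial (Fintype.card K : ℝ) (n - 1) k * #S * #L *
        (1 - #S * (Fintype.card K : ℝ) ^ (-(n : ℤ))) *
        (1 - #L * (Fintype.card K : ℝ) ^ ((k : ℤ) - n) * (qBinomial (Fintype.card K : ℝ) n k)⁻¹)) := by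
  set qR : ℝ := (Fintype.card K : ℝ) with hqR
  have hq0 : qR ≠ 0 := Nat.cast_ne_zero.2 Fintype.card_ne_zero
  have h := Real.abs_le_sqrt (sq_incidences_sub_le hk hkn S hL)
  have h' := (le_abs_self _).trans h
  have hz1 : qR ^ ((k : ℤ) - n) = qR ^ k / qR ^ n := by
    rw [zpow_sub₀ hq0, zpow_natCast, zpow_natCast]
  have hz2 : qR ^ (-(n : ℤ)) = (qR ^ n)⁻¹ := by rw [zpow_neg, zpow_natCast]
  have hsplit : qR ^ n = qR ^ (n - k) * qR ^ k := by rw [← pow_add, Nat.sub_add_cancel hkn]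
  rw [hz1, hz2]
  have e : qR ^ k * qBinomial qR (n - 1) k * #S * #L * (1 - #S * (qR ^ n)⁻¹) *
        (1 - #L * (qR ^ k / qR ^ n) * (qBinomial qR n k)⁻¹) =
      qR ^ k * qBinomial qR (n - 1) k * (#S * (1 - #S / qR ^ n)) *
        (#L * (1 - #L / (qR ^ (n - k) * qBinomial qR n k))) := by
    rw [hsplit]; field_simp
  rw [e]
  linarith

/-- Lemma 5, lower tail (the same design estimate bounds the deficit as well):
`I(S, L) ≥ q^{k−n}|S||L| − √(…)`. [cite: DharDvirLund2021FurstenbergFiniteFields, Lemma 5 (p. 4)] -/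
theorem le_incidences {k : ℕ} (hk : 1 ≤ k) (hkn : k ≤ n) (S : Finset (Fin n → K))
    {L : Finset (Finset (Fin n → K))} (hL : L ⊆ kFlats K n k) :
    (Fintype.card K : ℝ) ^ ((k : ℤ) - n) * #S * #L -
      Real.sqrt ((Fintype.card K : ℝ) ^ k * qBinomial (Fintype.card K : ℝ) (n - 1) k * #S * #L *
        (1 - #S * (Fintype.card K : ℝ) ^ (-(n : ℤ))) *
        (1 - #L * (Fintype.card K : ℝ) ^ ((k : ℤ) - n) * (qBinomial (Fintype.card K : ℝ) n k)⁻¹)) ≤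
      (incidences S L : ℝ) := by
  set qR : ℝ := (Fintype.card K : ℝ) with hqR
  have hq0 : qR ≠ 0 := Nat.cast_ne_zero.2 Fintype.card_ne_zero
  have h := Real.abs_le_sqrt (sq_incidences_sub_le hk hkn S hL)
  have h' := (neg_abs_le _).trans' (neg_le_neg h)
  have hz1 : qR ^ ((k : ℤ) - n) = qR ^ k / qR ^ n := by
    rw [zpow_sub₀ hq0, zpow_natCast, zpow_natCast]
  have hz2 : qR ^ (-(n : ℤ)) = (qR ^ n)⁻¹ := by rw [zpow_neg, zpow_natCast]
  have hsplit : qR ^ n = qR ^ (n - k) * qR ^ k := by rw [← pow_add, Nat.sub_add_cancel hkn]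
  rw [hz1, hz2]
  have e : qR ^ k * qBinomial qR (n - 1) k * #S * #L * (1 - #S * (qR ^ n)⁻¹) *
        (1 - #L * (qR ^ k / qR ^ n) * (qBinomial qR n k)⁻¹) =
      qR ^ k * qBinomial qR (n - 1) k * (#S * (1 - #S / qR ^ n)) *
        (#L * (1 - #L / (qR ^ (n - k) * qBinomial qR n k))) := by
    rw [hsplit]; field_simp
  rw [e]
  linarith

end Incidences

/-! ### §7: Lemma 23 and Theorem 3 -/

section PureIncidences

/-- The last step of the proof of Lemma 23 ("Since the coefficient of `ε²` in (21) is positive,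
`ε` must be greater than the smaller root of (21). Hence … `ε > δκ(κ+1)⁻¹ − √(δ(1−δ)κ⁻¹)`"):
if `κ > 0`, `0 < δ ≤ 1` and `(δ − ε)² κ ≤ ε(1 − ε)` (so that `0 ≤ ε`) then
`δκ(κ+1)⁻¹ − √(δ(1−δ)κ⁻¹) ≤ ε`.  (Proved directly: with `x = δ − ε`, `C = √(δ(1−δ)κ⁻¹)` and
`g(t) = (κ+1)t² − (2δ−1)t − δ(1−δ)`, (21) says `g(x) ≤ 0`, while `g(δ/(κ+1) + C) ≥ 0` and `g` is
increasing beyond that point.) [cite: DharDvirLund2021FurstenbergFiniteFields, Lemma 23 (proof, pp. 13–14)] -/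
theorem sub_sqrt_le_of_sq_mul_le {κ δ ε : ℝ} (hκ : 0 < κ) (hδ : 0 < δ) (hδ1 : δ ≤ 1)
    (h : (δ - ε) ^ 2 * κ ≤ ε * (1 - ε)) :
    δ * κ * (κ + 1)⁻¹ - Real.sqrt (δ * (1 - δ) * κ⁻¹) ≤ ε := by
  obtain ⟨C, hC⟩ : ∃ C, C = Real.sqrt (δ * (1 - δ) * κ⁻¹) := ⟨_, rfl⟩
  rw [← hC]
  have hC0 : 0 ≤ C := by rw [hC]; exact Real.sqrt_nonneg _
  have hrad : 0 ≤ δ * (1 - δ) * κ⁻¹ :=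
    mul_nonneg (mul_nonneg hδ.le (by linarith)) (inv_nonneg.2 hκ.le)
  have hCsq : C ^ 2 * κ = δ * (1 - δ) := by
    rw [hC, Real.sq_sqrt hrad]
    field_simp
  have hκ1 : 0 < κ + 1 := by linarith
  obtain ⟨u, hu⟩ : ∃ u, u = δ / (κ + 1) := ⟨_, rfl⟩
  have hu' : u * (κ + 1) = δ := by rw [hu]; field_simp
  have hu0 : 0 < u := by rw [hu]; exact div_pos hδ hκ1
  have hkey : δ * κ * (κ + 1)⁻¹ = δ - u := by rw [hu]; field_simp; ring
  rw [hkey]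
  by_contra hlt
  have hlt' : ε < δ - u - C := lt_of_not_ge hlt
  -- `x = δ − ε > x₀ = u + C > 0`, `u = δ/(κ+1)`
  obtain ⟨x, hx⟩ : ∃ x, x = δ - ε := ⟨_, rfl⟩
  have hxx : u + C < x := by rw [hx]; linarith
  -- (21) says `g(x) ≤ 0` for `g(t) = (κ+1)t² − (2δ−1)t − δ(1−δ)`
  have hgx : (κ + 1) * x ^ 2 - (2 * δ - 1) * x - δ * (1 - δ) ≤ 0 := by
    have e : (κ + 1) * x ^ 2 - (2 * δ - 1) * x - δ * (1 - δ) =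
        (δ - ε) ^ 2 * κ - ε * (1 - ε) := by
      rw [hx]; ring
    rw [e]; linarith
  -- `g(x₀) = u(1 − δ) + C + C² ≥ 0`
  have hg0 : (κ + 1) * (u + C) ^ 2 - (2 * δ - 1) * (u + C) - δ * (1 - δ) =
      u * (1 - δ) + C + C ^ 2 := by
    linear_combination hCsq + (u + 2 * C) * hu'
  have hg0' : 0 ≤ (κ + 1) * (u + C) ^ 2 - (2 * δ - 1) * (u + C) - δ * (1 - δ) := by
    rw [hg0]
    have h1 : 0 ≤ u * (1 - δ) := mul_nonneg hu0.le (by linarith)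
    nlinarith [sq_nonneg C]
  -- `g(x) − g(x₀) = (x − x₀)((κ+1)(x − x₀) + 2(κ+1)C + 1) > 0`
  have hdiff : ((κ + 1) * x ^ 2 - (2 * δ - 1) * x - δ * (1 - δ)) -
      ((κ + 1) * (u + C) ^ 2 - (2 * δ - 1) * (u + C) - δ * (1 - δ)) =
        (x - (u + C)) * ((κ + 1) * (x - (u + C)) + 2 * (κ + 1) * C + 1) := by
    linear_combination (2 * (x - (u + C))) * hu'
  have hpos : 0 < (x - (u + C)) * ((κ + 1) * (x - (u + C)) + 2 * (κ + 1) * C + 1) := by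
    have h1 : 0 < x - (u + C) := sub_pos.2 hxx
    have h2 : 0 < (κ + 1) * (x - (u + C)) + 2 * (κ + 1) * C + 1 := by
      have h3 : 0 < (κ + 1) * (x - (u + C)) := mul_pos hκ1 h1
      have h4 : 0 ≤ 2 * (κ + 1) * C := by positivity
      linarith
    exact mul_pos h1 h2
  linarith

variable {n : ℕ} [Fintype K] [DecidableEq K]

/-- A flat of `L` witnesses `δ ≤ 1` and `L` is nonempty when `|L| ≥ γ q^{n−ℓ}[n choose ℓ]_q > 0`. [folklore] -/
private theorem delta_le_one {ℓ : ℕ} (P : Finset (Fin n → K)) {δ : ℝ}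
    {L : Finset (Finset (Fin n → K))} (hL : L ⊆ kFlats K n ℓ) (hne : L.Nonempty)
    (hrich : ∀ F ∈ L, δ * (Fintype.card K : ℝ) ^ ℓ ≤ #(P.filter fun x => x ∈ F)) : δ ≤ 1 := by
  obtain ⟨F, hF⟩ := hne
  have h1 := hrich F hF
  have h2 : #(P.filter fun x => x ∈ F) ≤ #F := by
    calc #(P.filter fun x => x ∈ F) ≤ #(P ∩ F) := by rw [filter_mem_eq_inter]
      _ ≤ #F := card_le_card inter_subset_right
  have h3 : (#F : ℝ) = (Fintype.card K : ℝ) ^ ℓ := by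
    rw [card_of_mem_kFlats (hL hF)]; push_cast; rfl
  have hq : (0 : ℝ) < (Fintype.card K : ℝ) ^ ℓ := pow_pos (Nat.cast_pos.2 Fintype.card_pos) _
  have h4 : δ * (Fintype.card K : ℝ) ^ ℓ ≤ (Fintype.card K : ℝ) ^ ℓ := by
    calc δ * (Fintype.card K : ℝ) ^ ℓ ≤ #(P.filter fun x => x ∈ F) := h1
      _ ≤ #F := by exact_mod_cast h2
      _ = _ := h3
  nlinarith

/-- **Lemma 23, with the hypothesis `|L| = γ q^{n−ℓ}[n choose ℓ]_q` relaxed to `≥`** (the printed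
proof uses only the lower bound on `|L|`; this is the form needed in the proof of Theorem 2, where
`|G_r|` is only bounded from below).  Let `P ⊆ 𝔽_qⁿ`, `δ, γ > 0`, `1 ≤ ℓ ≤ n`, and let `L` be a set
of `ℓ`-flats each containing at least `δ q^ℓ` points of `P`, with `|L| ≥ γ q^{n−ℓ}[n choose ℓ]_q`;
`κ = γ q^ℓ`.  Then `|P| ≥ (δκ(κ+1)⁻¹ − √(δ(1−δ)κ⁻¹)) qⁿ`.
Proof as printed: `ε = |P| q^{−n}`; if `ε ≥ δ` done; else `I(P, L) ≥ δ q^ℓ |L|` and Lemma 5 give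
`(δ − ε)² q^ℓ |L| ≤ ε qⁿ (1 − ε) [n−1 choose ℓ]_q`, and `[n choose ℓ]_q > q^ℓ [n−1 choose ℓ]_q`
(Pascal) gives (21) `(δ − ε)² κ − ε(1 − ε) < 0`, whence the bound (`sub_sqrt_le_of_sq_mul_le`).
[cite: DharDvirLund2021FurstenbergFiniteFields, Lemma 23 (pp. 13–14)] -/
theorem sub_sqrt_mul_pow_le_card_of_le {ℓ : ℕ} (hℓ : 1 ≤ ℓ) (hℓn : ℓ ≤ n)
    (P : Finset (Fin n → K)) {δ γ : ℝ} (hδ : 0 < δ) (hγ : 0 < γ)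
    {L : Finset (Finset (Fin n → K))} (hL : L ⊆ kFlats K n ℓ)
    (hrich : ∀ F ∈ L, δ * (Fintype.card K : ℝ) ^ ℓ ≤ #(P.filter fun x => x ∈ F))
    (hcard : γ * (Fintype.card K : ℝ) ^ (n - ℓ) * qBinomial (Fintype.card K : ℝ) n ℓ ≤ #L) :
    (δ * (γ * (Fintype.card K : ℝ) ^ ℓ) * (γ * (Fintype.card K : ℝ) ^ ℓ + 1)⁻¹ -
        Real.sqrt (δ * (1 - δ) * (γ * (Fintype.card K : ℝ) ^ ℓ)⁻¹)) *
      (Fintype.card K : ℝ) ^ n ≤ #P := by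
  set qR : ℝ := (Fintype.card K : ℝ) with hqR
  have hq : (0 : ℝ) < qR := Nat.cast_pos.2 Fintype.card_pos
  have hq0 : qR ≠ 0 := hq.ne'
  have hqn : (0 : ℝ) < qR ^ n := pow_pos hq _
  have hqℓ : (0 : ℝ) < qR ^ ℓ := pow_pos hq _
  obtain ⟨κ, hκ⟩ : ∃ κ : ℝ, κ = γ * qR ^ ℓ := ⟨_, rfl⟩
  rw [← hκ]
  have hκ0 : 0 < κ := by rw [hκ]; exact mul_pos hγ hqℓ
  obtain ⟨ε, hε⟩ : ∃ ε : ℝ, ε = #P / qR ^ n := ⟨_, rfl⟩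
  have hPε : (#P : ℝ) = ε * qR ^ n := by rw [hε]; field_simp
  have hε0 : 0 ≤ ε := by rw [hε]; exact div_nonneg (Nat.cast_nonneg _) hqn.le
  have hε1 : ε ≤ 1 := by
    rw [hε, div_le_one hqn]
    have h1 : #P ≤ Fintype.card (Fin n → K) := card_le_univ P
    rw [Fintype.card_fun, Fintype.card_fin] at h1
    rw [hqR]; exact_mod_cast h1
  -- `L` is nonempty, so `δ ≤ 1`
  have hB1 : 1 ≤ qBinomial qR n ℓ := one_le_qBinomial hq.le hℓn
  have hLpos : (0 : ℝ) < #L := lt_of_lt_of_le (by positivity) hcard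
  have hne : L.Nonempty := by
    rw [← card_pos]; exact_mod_cast hLpos
  have hδ1 : δ ≤ 1 := delta_le_one P hL hne hrich
  rw [hPε]
  rcases le_or_gt δ ε with hδε | hεδ
  · -- `ε ≥ δ`: `|P| ≥ δ qⁿ`, stronger than the claim
    have h1 : δ * κ * (κ + 1)⁻¹ ≤ δ := by
      rw [mul_assoc]
      refine mul_le_of_le_one_right hδ.le ?_
      rw [← div_eq_mul_inv, div_le_one (by linarith)]
      linarith
    have h2 : 0 ≤ Real.sqrt (δ * (1 - δ) * κ⁻¹) := Real.sqrt_nonneg _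
    exact mul_le_mul_of_nonneg_right (by linarith) hqn.le
  · -- `ε < δ`: count incidences
    have hI : δ * qR ^ ℓ * #L ≤ incidences P L := by
      have h1 := sum_le_sum hrich
      rw [sum_const, nsmul_eq_mul] at h1
      calc δ * qR ^ ℓ * #L = #L * (δ * qR ^ ℓ) := by ring
        _ ≤ _ := h1
        _ = _ := by rw [incidences_eq_sum_flats, Nat.cast_sum]
    have hsq := sq_incidences_sub_le hℓ hℓn P hL
    -- `(δ q^ℓ |L| − ε q^ℓ |L|)² ≤ (I − ε q^ℓ |L|)²`
    have hmean : qR ^ ℓ / qR ^ n * #P * #L = ε * qR ^ ℓ * #L := by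
      rw [hε]; ring
    rw [hmean] at hsq
    have hlow : ((δ - ε) * qR ^ ℓ * #L) ^ 2 ≤ (incidences P L - ε * qR ^ ℓ * #L) ^ 2 := by
      have h0 : 0 ≤ (δ - ε) * qR ^ ℓ * #L :=
        mul_nonneg (mul_nonneg (by linarith) hqℓ.le) (Nat.cast_nonneg _)
      have h1 : (δ - ε) * qR ^ ℓ * #L ≤ incidences P L - ε * qR ^ ℓ * #L := by linarith
      exact pow_le_pow_left₀ h0 h1 2
    -- the right-hand side of Lemma 5 is at most `q^ℓ [n−1 choose ℓ]_q |P| (1 − ε) |L|`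
    have hBn : 0 ≤ qBinomial qR (n - 1) ℓ := qBinomial_nonneg hq.le _ _
    have hLb : (#L : ℝ) ≤ qR ^ (n - ℓ) * qBinomial qR n ℓ := by
      rw [← card_kFlats_eq hℓ hℓn]; exact_mod_cast card_le_card hL
    have hbpos : 0 < qR ^ (n - ℓ) * qBinomial qR n ℓ := mul_pos (pow_pos hq _) (by linarith)
    have hfac : #L * (1 - #L / (qR ^ (n - ℓ) * qBinomial qR n ℓ)) ≤ #L := by
      have h1 : 0 ≤ #L / (qR ^ (n - ℓ) * qBinomial qR n ℓ) := div_nonneg hLpos.le hbpos.le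
      nlinarith
    have hPfac : 0 ≤ (#P : ℝ) * (1 - #P / qR ^ n) := by
      rw [← hε]; exact mul_nonneg (Nat.cast_nonneg _) (by linarith)
    have hA : 0 ≤ qR ^ ℓ * qBinomial qR (n - 1) ℓ * (#P * (1 - #P / qR ^ n)) :=
      mul_nonneg (mul_nonneg hqℓ.le hBn) hPfac
    have hup : qR ^ ℓ * qBinomial qR (n - 1) ℓ * (#P * (1 - #P / qR ^ n)) *
        (#L * (1 - #L / (qR ^ (n - ℓ) * qBinomial qR n ℓ))) ≤
        qR ^ ℓ * qBinomial qR (n - 1) ℓ * (#P * (1 - #P / qR ^ n)) * #L :=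
      mul_le_mul_of_nonneg_left hfac hA
    have hmain : ((δ - ε) * qR ^ ℓ * #L) ^ 2 ≤
        qR ^ ℓ * qBinomial qR (n - 1) ℓ * (#P * (1 - #P / qR ^ n)) * #L :=
      hlow.trans (hsq.trans hup)
    have hPfac' : (#P : ℝ) * (1 - #P / qR ^ n) = ε * qR ^ n * (1 - ε) := by
      rw [hPε, mul_div_cancel_right₀ ε hqn.ne']
    rw [hPfac'] at hmain
    -- divide by `q^ℓ |L| > 0`: `(δ − ε)² q^ℓ |L| ≤ ε (1 − ε) qⁿ [n−1 choose ℓ]_q`   (*)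
    have hstar : (δ - ε) ^ 2 * qR ^ ℓ * #L ≤ ε * (1 - ε) * qR ^ n * qBinomial qR (n - 1) ℓ := by
      have h1 : ((δ - ε) * qR ^ ℓ * #L) ^ 2 = ((δ - ε) ^ 2 * qR ^ ℓ * #L) * (qR ^ ℓ * #L) := by
        ring
      have h2 : qR ^ ℓ * qBinomial qR (n - 1) ℓ * (ε * qR ^ n * (1 - ε)) * #L =
          (ε * (1 - ε) * qR ^ n * qBinomial qR (n - 1) ℓ) * (qR ^ ℓ * #L) := by ring
      rw [h1, h2] at hmain
      exact le_of_mul_le_mul_right hmain (mul_pos hqℓ hLpos)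
    -- `|L| ≥ γ q^{n−ℓ}[n choose ℓ]_q ≥ γ qⁿ [n−1 choose ℓ]_q + γ q^{n−ℓ}`
    -- (Pascal: `[n choose ℓ]_q = q^ℓ [n−1 choose ℓ]_q + [n−1 choose ℓ−1]_q`, `[n−1 choose ℓ−1]_q ≥ 1`)
    have hpas := qBinomial_pascal qR (le_trans hℓ hℓn) hℓ
    have hB2 : 1 ≤ qBinomial qR (n - 1) (ℓ - 1) := one_le_qBinomial hq.le (by omega)
    have hsplit : qR ^ n = qR ^ (n - ℓ) * qR ^ ℓ := by rw [← pow_add, Nat.sub_add_cancel hℓn]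
    have hγq : 0 ≤ γ * qR ^ (n - ℓ) := mul_nonneg hγ.le (pow_pos hq _).le
    have hLge : γ * qR ^ n * qBinomial qR (n - 1) ℓ + γ * qR ^ (n - ℓ) ≤ #L := by
      have e1 : γ * qR ^ n * qBinomial qR (n - 1) ℓ + γ * qR ^ (n - ℓ) =
          γ * qR ^ n * qBinomial qR (n - 1) ℓ + γ * qR ^ (n - ℓ) * 1 := by ring
      have e2 : γ * qR ^ (n - ℓ) * qBinomial qR n ℓ =
          γ * qR ^ n * qBinomial qR (n - 1) ℓ + γ * qR ^ (n - ℓ) * qBinomial qR (n - 1) (ℓ - 1) := by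
        rw [hpas, hsplit]; ring
      have h1 : γ * qR ^ n * qBinomial qR (n - 1) ℓ + γ * qR ^ (n - ℓ) ≤
          γ * qR ^ (n - ℓ) * qBinomial qR n ℓ := by
        rw [e1, e2]
        linarith [mul_le_mul_of_nonneg_left hB2 hγq]
      exact h1.trans hcard
    -- (21): `(δ − ε)² κ ≤ ε (1 − ε)`
    have hde : 0 < (δ - ε) ^ 2 * qR ^ ℓ := mul_pos (by nlinarith) hqℓ
    have h1 : (δ - ε) ^ 2 * qR ^ ℓ * (γ * qR ^ n * qBinomial qR (n - 1) ℓ + γ * qR ^ (n - ℓ)) ≤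
        ε * (1 - ε) * qR ^ n * qBinomial qR (n - 1) ℓ :=
      (mul_le_mul_of_nonneg_left hLge hde.le).trans hstar
    have h3 : 0 < (δ - ε) ^ 2 * qR ^ ℓ * (γ * qR ^ (n - ℓ)) :=
      mul_pos hde (mul_pos hγ (pow_pos hq _))
    have h21 : (δ - ε) ^ 2 * κ ≤ ε * (1 - ε) := by
      -- either `[n−1 choose ℓ]_q > 0` and we divide, or it is `0` and `h1` is absurd
      rcases hBn.eq_or_lt with hB0 | hBpos
      · rw [← hB0] at h1
        simp only [mul_zero, zero_add] at h1
        linarith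
      · have e : (δ - ε) ^ 2 * κ * (qR ^ n * qBinomial qR (n - 1) ℓ) =
            (δ - ε) ^ 2 * qR ^ ℓ * (γ * qR ^ n * qBinomial qR (n - 1) ℓ + γ * qR ^ (n - ℓ)) -
              (δ - ε) ^ 2 * qR ^ ℓ * (γ * qR ^ (n - ℓ)) := by
          rw [hκ]; ring
        have h2 : (δ - ε) ^ 2 * κ * (qR ^ n * qBinomial qR (n - 1) ℓ) ≤
            ε * (1 - ε) * (qR ^ n * qBinomial qR (n - 1) ℓ) := by
          rw [e]; linarith
        exact le_of_mul_le_mul_right h2 (mul_pos hqn hBpos)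
    exact mul_le_mul_of_nonneg_right (sub_sqrt_le_of_sq_mul_le hκ0 hδ hδ1 h21) hqn.le

/-- **Lemma 23, exactly as printed.** "Let `P ⊆ 𝔽_qⁿ` be a set of points. Let `δ, γ > 0`, and let
`L` be a set of `ℓ`-flats that each contain at least `δ q^ℓ` points of `P`, and suppose that
`|L| = γ q^{n−ℓ} [n choose ℓ]_q`. Let `κ = γ q^ℓ`. Then
`|P| ≥ (δκ(κ+1)⁻¹ − √(δ(1−δ)κ⁻¹)) qⁿ`."  (Here `1 ≤ ℓ ≤ n`.)
[cite: DharDvirLund2021FurstenbergFiniteFields, Lemma 23 (p. 13)] -/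
theorem sub_sqrt_mul_pow_le_card {ℓ : ℕ} (hℓ : 1 ≤ ℓ) (hℓn : ℓ ≤ n)
    (P : Finset (Fin n → K)) {δ γ : ℝ} (hδ : 0 < δ) (hγ : 0 < γ)
    {L : Finset (Finset (Fin n → K))} (hL : L ⊆ kFlats K n ℓ)
    (hrich : ∀ F ∈ L, δ * (Fintype.card K : ℝ) ^ ℓ ≤ #(P.filter fun x => x ∈ F))
    (hcard : (#L : ℝ) = γ * (Fintype.card K : ℝ) ^ (n - ℓ) * qBinomial (Fintype.card K : ℝ) n ℓ) :
    (δ * (γ * (Fintype.card K : ℝ) ^ ℓ) * (γ * (Fintype.card K : ℝ) ^ ℓ + 1)⁻¹ -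
        Real.sqrt (δ * (1 - δ) * (γ * (Fintype.card K : ℝ) ^ ℓ)⁻¹)) *
      (Fintype.card K : ℝ) ^ n ≤ #P :=
  sub_sqrt_mul_pow_le_card_of_le hℓ hℓn P hδ hγ hL hrich hcard.symm.le


/-- **Theorem 3 (Dhar–Dvir–Lund), exactly as printed.** "Let `q` be a prime power, and let `n, k,`
and `m` be integers with `n/2 < k < n` and `0 ≤ m ≤ q^k`. Let `S ⊆ 𝔽_qⁿ`. Let `L` be a set of
`k`-flats that each contain at least `m` points of `S`, with `|L| = [n choose k]_q`. Then,
`|S| ≥ (1 − q^{n−2k} − √(q^{n−k} m^{−1})) m q^{n−k}`."  (For `m = 0` the left side is `0`.)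
Proof as printed: Lemma 23 with `δ = m q^{−k}`, `γ = q^{k−n}`, `κ = q^{2k−n}`, followed by
`κ(κ+1)⁻¹ = 1 − (κ+1)⁻¹ ≥ 1 − κ⁻¹ = 1 − q^{n−2k}` and `√((1 − mq^{−k}) q^{n−k} m^{−1}) ≤ √(q^{n−k} m^{−1})`
(the printed two-line expansion of these two elementary estimates is shortened).
[cite: DharDvirLund2021FurstenbergFiniteFields, Theorem 3 (p. 3; proof p. 14)] -/
theorem mul_le_card_of_rich_flats {k m : ℕ} (hkn : k < n) (hnk : n < 2 * k)
    (hm : m ≤ Fintype.card K ^ k) (S : Finset (Fin n → K))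
    {L : Finset (Finset (Fin n → K))} (hL : L ⊆ kFlats K n k)
    (hrich : ∀ F ∈ L, m ≤ #(S.filter fun x => x ∈ F))
    (hcard : (#L : ℝ) = qBinomial (Fintype.card K : ℝ) n k) :
    (1 - (Fintype.card K : ℝ) ^ ((n : ℤ) - 2 * k) -
        Real.sqrt ((Fintype.card K : ℝ) ^ (n - k) * (m : ℝ)⁻¹)) * m *
      (Fintype.card K : ℝ) ^ (n - k) ≤ #S := by
  rcases Nat.eq_zero_or_pos m with rfl | hm0
  · simp
  set qR : ℝ := (Fintype.card K : ℝ) with hqR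
  have hq : (0 : ℝ) < qR := Nat.cast_pos.2 Fintype.card_pos
  have hq0 : qR ≠ 0 := hq.ne'
  have hk : 1 ≤ k := by omega
  -- `a = q^k`, `b = q^{n−k}`, `qⁿ = a b`, `q^{n−2k} = b/a`
  obtain ⟨a, ha⟩ : ∃ a : ℝ, a = qR ^ k := ⟨_, rfl⟩
  obtain ⟨b, hb⟩ : ∃ b : ℝ, b = qR ^ (n - k) := ⟨_, rfl⟩
  have ha0 : 0 < a := by rw [ha]; exact pow_pos hq _
  have hb0 : 0 < b := by rw [hb]; exact pow_pos hq _
  have hab : qR ^ n = a * b := by rw [ha, hb, ← pow_add, Nat.add_sub_cancel' hkn.le]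
  have hz : qR ^ ((n : ℤ) - 2 * k) = b / a := by
    rw [show ((n : ℤ) - 2 * k) = ((n - k : ℕ) : ℤ) - (k : ℕ) by push_cast [Nat.cast_sub hkn.le]; ring,
      zpow_sub₀ hq0, zpow_natCast, zpow_natCast, hb, ha]
  have hmR : (0 : ℝ) < m := Nat.cast_pos.2 hm0
  have hma : (m : ℝ) ≤ a := by rw [ha, hqR]; exact_mod_cast hm
  -- Lemma 23 with `δ = m/a`, `γ = 1/b` (`= q^{k−n}`), `ℓ = k`; `κ = a/b`
  have hδ : 0 < (m : ℝ) / a := div_pos hmR ha0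
  have hγ : 0 < b⁻¹ := inv_pos.2 hb0
  have hrich' : ∀ F ∈ L, (m : ℝ) / a * qR ^ k ≤ #(S.filter fun x => x ∈ F) := by
    intro F hF
    rw [← ha, div_mul_cancel₀ _ ha0.ne']
    exact_mod_cast hrich F hF
  have hcard' : b⁻¹ * qR ^ (n - k) * qBinomial qR n k ≤ #L := by
    rw [← hb, inv_mul_cancel₀ hb0.ne', one_mul, hcard]
  have h := sub_sqrt_mul_pow_le_card_of_le hk hkn.le S hδ hγ hL hrich' hcard'
  rw [← ha, hab] at h
  rw [hz, ← hb]
  -- first term: `m b (1 − b/a) ≤ δκ(κ+1)⁻¹ qⁿ = m a b/(a + b)`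
  have hT1 : (1 - b / a) * m * b ≤ (m : ℝ) / a * (b⁻¹ * a) * (b⁻¹ * a + 1)⁻¹ * (a * b) := by
    have e1 : (m : ℝ) / a * (b⁻¹ * a) * (b⁻¹ * a + 1)⁻¹ * (a * b) = m * a * b / (a + b) := by
      field_simp
    have e2 : (1 - b / a) * m * b = m * b * (a - b) / a := by
      field_simp
    rw [e1, e2, div_le_div_iff₀ ha0 (by positivity)]
    have : 0 ≤ (m : ℝ) * b * b ^ 2 := by positivity
    nlinarith
  -- second term: `√(δ(1−δ)κ⁻¹) qⁿ ≤ √(q^{n−k} m⁻¹) m q^{n−k}`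
  have hT2 : Real.sqrt ((m : ℝ) / a * (1 - m / a) * (b⁻¹ * a)⁻¹) * (a * b) ≤
      Real.sqrt (b * (m : ℝ)⁻¹) * m * b := by
    have hr1 : 0 ≤ (m : ℝ) / a * (1 - m / a) * (b⁻¹ * a)⁻¹ := by
      have : 0 ≤ 1 - (m : ℝ) / a := by
        rw [sub_nonneg, div_le_one ha0]; exact hma
      positivity
    have hr2 : 0 ≤ b * (m : ℝ)⁻¹ := by positivity
    rw [mul_assoc (Real.sqrt (b * (m : ℝ)⁻¹)), ← Real.sqrt_sq (by positivity : 0 ≤ a * b),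
      ← Real.sqrt_sq (by positivity : 0 ≤ (m : ℝ) * b), ← Real.sqrt_mul hr1, ← Real.sqrt_mul hr2]
    apply Real.sqrt_le_sqrt
    have e1 : (m : ℝ) / a * (1 - m / a) * (b⁻¹ * a)⁻¹ * (a * b) ^ 2 =
        m * b ^ 3 - m ^ 2 * b ^ 3 / a := by
      field_simp
    have e2 : b * (m : ℝ)⁻¹ * ((m : ℝ) * b) ^ 2 = m * b ^ 3 := by
      field_simp
    rw [e1, e2]
    have : 0 ≤ (m : ℝ) ^ 2 * b ^ 3 / a := by positivity
    linarith
  calc (1 - b / a - Real.sqrt (b * (m : ℝ)⁻¹)) * m * b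
      = (1 - b / a) * m * b - Real.sqrt (b * (m : ℝ)⁻¹) * m * b := by ring
    _ ≤ (m : ℝ) / a * (b⁻¹ * a) * (b⁻¹ * a + 1)⁻¹ * (a * b) -
        Real.sqrt ((m : ℝ) / a * (1 - m / a) * (b⁻¹ * a)⁻¹) * (a * b) := by linarith
    _ = _ := by ring
    _ ≤ #S := h

/-- Points of a finset on a translate, counted as in `IsFurstenberg`. [folklore] -/
private theorem card_filter_mem_translate (S : Finset (Fin n → K)) (W : Submodule K (Fin n → K))
    (x : Fin n → K) :
    #(S.filter fun y => y ∈ translate W x) = {y ∈ (S : Set (Fin n → K)) | y - x ∈ W}.ncard := by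
  rw [← Set.ncard_coe_finset]
  congr 1
  ext y
  simp [mem_translate]

/-- **Theorem 3, "In particular, the same lower bound holds for `K(q, n, k, m)`"**: for
`n/2 < k < n` and `m ≤ q^k`, `K(q, n, k, m) ≥ (1 − q^{n−2k} − √(q^{n−k} m^{−1})) m q^{n−k}`
(a `(k, m)`-Furstenberg set has a translate of each of the `[n choose k]_q` rank-`k` subspaces with
at least `m` of its points; these are `[n choose k]_q` distinct `k`-flats).
[cite: DharDvirLund2021FurstenbergFiniteFields, Theorem 3 (p. 3)] -/
theorem mul_le_furstenbergNumber {k m : ℕ} (hkn : k < n) (hnk : n < 2 * k)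
    (hm : m ≤ Fintype.card K ^ k) :
    (1 - (Fintype.card K : ℝ) ^ ((n : ℤ) - 2 * k) -
        Real.sqrt ((Fintype.card K : ℝ) ^ (n - k) * (m : ℝ)⁻¹)) * m *
      (Fintype.card K : ℝ) ^ (n - k) ≤ (furstenbergNumber K n k m : ℝ) := by
  classical
  obtain ⟨S, hS, hF⟩ := exists_card_eq_furstenbergNumber (K := K) hkn.le hm
  rw [← hS]
  -- one rich translate per rank-`k` subspace
  have hch : ∀ W : {W : Submodule K (Fin n → K) // finrank K W = k},
      ∃ x : Fin n → K, m ≤ #(S.filter fun y => y ∈ translate W.1 x) := by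
    intro W
    obtain ⟨x, hx⟩ := hF W.1 W.2
    exact ⟨x, by rwa [card_filter_mem_translate]⟩
  choose x hx using hch
  have hinj : Function.Injective
      (fun W : {W : Submodule K (Fin n → K) // finrank K W = k} => translate W.1 (x W)) :=
    fun W W' h => Subtype.ext (eq_of_translate_eq h)
  refine mul_le_card_of_rich_flats hkn hnk hm S (L := univ.image fun W => translate W.1 (x W))
    ?_ ?_ ?_
  · intro F hF
    obtain ⟨W, -, rfl⟩ := mem_image.1 hF
    exact translate_mem_kFlats W.2 _
  · intro F hF
    obtain ⟨W, -, rfl⟩ := mem_image.1 hF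
    exact hx W
  · rw [card_image_of_injective _ hinj, card_univ]
    have h1 := card_subspaces_eq_qBinomial n k (K := K)
    have h2 := cast_qBinomial (Fintype.card K : ℤ) n k
    push_cast at h2
    rw [← h2]
    exact_mod_cast h1

end PureIncidences

/-! ### §2.1: Lemma 6 — few flats are poor (Lund–Saraf, Alon) -/

section PoorFlats

variable {n : ℕ} [Fintype K] [DecidableEq K]

/-- **Lemma 6 (poor flats), multiplied out, for any family of poor flats.**  In `𝔽_qⁿ` let `S` be a
set of `m` points and `L_p` a set of `ℓ`-flats (`1 ≤ ℓ ≤ n`) each containing at most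
`δ · m q^{ℓ−n}` points of `S`, `δ ≤ 1`.  Then `|L_p| (1 + m q^{ℓ−n} (1 − δ)²) ≤ q^{n−ℓ} [n choose ℓ]_q`
(the number of all `ℓ`-flats).  Proof: the squared form of Lemma 5 for `(S, L_p)` is a
Chebyshev–Cantelli inequality: with `μ = m q^{ℓ−n}`, `I(S, L_p) ≤ δ μ |L_p|` gives
`((1−δ) μ |L_p|)² ≤ q^ℓ [n−1 choose ℓ]_q m |L_p| (1 − |L_p|/b)`, and `[n choose ℓ]_q ≥ q^ℓ [n−1 choose ℓ]_q`.
[cite: DharDvirLund2021FurstenbergFiniteFields, Lemma 6 (p. 4)] -/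
theorem card_mul_le_of_poor {ℓ : ℕ} (hℓ : 1 ≤ ℓ) (hℓn : ℓ ≤ n) (S : Finset (Fin n → K))
    {δ : ℝ} (hδ1 : δ ≤ 1) {Lp : Finset (Finset (Fin n → K))} (hLp : Lp ⊆ kFlats K n ℓ)
    (hpoor : ∀ F ∈ Lp, (#(S.filter fun x => x ∈ F) : ℝ) ≤
      δ * (#S * (Fintype.card K : ℝ) ^ ℓ / (Fintype.card K : ℝ) ^ n)) :
    (#Lp : ℝ) * (1 + #S * (Fintype.card K : ℝ) ^ ℓ / (Fintype.card K : ℝ) ^ n * (1 - δ) ^ 2) ≤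
      (Fintype.card K : ℝ) ^ (n - ℓ) * qBinomial (Fintype.card K : ℝ) n ℓ := by
  set qR : ℝ := (Fintype.card K : ℝ) with hqR
  have hq : (0 : ℝ) < qR := Nat.cast_pos.2 Fintype.card_pos
  have hqn : (0 : ℝ) < qR ^ n := pow_pos hq _
  have hqℓ : (0 : ℝ) < qR ^ ℓ := pow_pos hq _
  obtain ⟨μ, hμ⟩ : ∃ μ : ℝ, μ = #S * qR ^ ℓ / qR ^ n := ⟨_, rfl⟩
  rw [← hμ] at hpoor ⊢
  have hμ0 : 0 ≤ μ := by rw [hμ]; positivity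
  obtain ⟨b, hb⟩ : ∃ b : ℝ, b = qR ^ (n - ℓ) * qBinomial qR n ℓ := ⟨_, rfl⟩
  rw [← hb]
  have hB1 : 1 ≤ qBinomial qR n ℓ := one_le_qBinomial hq.le hℓn
  have hb0 : 0 < b := by rw [hb]; exact mul_pos (pow_pos hq _) (by linarith)
  have hLb : (#Lp : ℝ) ≤ b := by
    rw [hb, ← card_kFlats_eq hℓ hℓn]; exact_mod_cast card_le_card hLp
  have hBn : 0 ≤ qBinomial qR (n - 1) ℓ := qBinomial_nonneg hq.le _ _
  obtain ⟨A, hA⟩ : ∃ A : ℝ, A = qR ^ ℓ * qBinomial qR (n - 1) ℓ * #S := ⟨_, rfl⟩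
  have hA0 : 0 ≤ A := by rw [hA]; positivity
  -- incidences: `I(S, L_p) ≤ δ μ |L_p|`
  have hI : (incidences S Lp : ℝ) ≤ δ * μ * #Lp := by
    have h1 := sum_le_sum hpoor
    rw [sum_const, nsmul_eq_mul] at h1
    calc (incidences S Lp : ℝ) = ∑ F ∈ Lp, (#(S.filter fun x => x ∈ F) : ℝ) := by
          rw [incidences_eq_sum_flats, Nat.cast_sum]
      _ ≤ #Lp * (δ * μ) := h1
      _ = δ * μ * #Lp := by ring
  -- Lemma 5, squared form, with the factor `(1 − |S| q^{−n}) ≤ 1` dropped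
  have hsq := sq_incidences_sub_le hℓ hℓn S hLp
  have hmean : qR ^ ℓ / qR ^ n * #S * #Lp = μ * #Lp := by rw [hμ]; ring
  rw [hmean, ← hb] at hsq
  have hS1 : (#S : ℝ) * (1 - #S / qR ^ n) ≤ #S := by
    have : 0 ≤ (#S : ℝ) / qR ^ n := by positivity
    nlinarith
  have hfacL : 0 ≤ (#Lp : ℝ) * (1 - #Lp / b) := by
    apply mul_nonneg (Nat.cast_nonneg _)
    rw [sub_nonneg, div_le_one hb0]; exact hLb
  have hup : qR ^ ℓ * qBinomial qR (n - 1) ℓ * (#S * (1 - #S / qR ^ n)) * (#Lp * (1 - #Lp / b)) ≤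
      A * (#Lp * (1 - #Lp / b)) := by
    rw [hA]
    exact mul_le_mul_of_nonneg_right (mul_le_mul_of_nonneg_left hS1 (by positivity)) hfacL
  have hlow : ((1 - δ) * μ * #Lp) ^ 2 ≤ ((incidences S Lp : ℝ) - μ * #Lp) ^ 2 := by
    have h0 : 0 ≤ (1 - δ) * μ * #Lp := by
      have : 0 ≤ 1 - δ := by linarith
      positivity
    have h1 : (1 - δ) * μ * #Lp ≤ μ * #Lp - incidences S Lp := by nlinarith
    calc ((1 - δ) * μ * #Lp) ^ 2 ≤ (μ * #Lp - incidences S Lp) ^ 2 := pow_le_pow_left₀ h0 h1 2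
      _ = ((incidences S Lp : ℝ) - μ * #Lp) ^ 2 := by ring
  -- (∗∗) `((1−δ) μ |L_p|)² ≤ A |L_p| (1 − |L_p|/b)`
  have hmain : ((1 - δ) * μ * #Lp) ^ 2 ≤ A * (#Lp * (1 - #Lp / b)) := hlow.trans (hsq.trans hup)
  -- `μ b ≥ A`, i.e. `[n choose ℓ]_q ≥ q^ℓ [n−1 choose ℓ]_q`
  have hμb : A ≤ μ * b := by
    have hpas := qBinomial_pascal qR (le_trans hℓ hℓn) hℓ
    have hB2 : 1 ≤ qBinomial qR (n - 1) (ℓ - 1) := one_le_qBinomial hq.le (by omega)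
    have hsplit : qR ^ n = qR ^ (n - ℓ) * qR ^ ℓ := by rw [← pow_add, Nat.sub_add_cancel hℓn]
    have e : μ * b = #S * qBinomial qR n ℓ := by
      rw [hμ, hb, hsplit]; field_simp
    rw [e, hA, hpas]
    have : 0 ≤ (#S : ℝ) * qBinomial qR (n - 1) (ℓ - 1) := by positivity
    nlinarith
  -- conclude
  rcases Nat.eq_zero_or_pos #Lp with hN0 | hNpos
  · rw [hN0, Nat.cast_zero, zero_mul]; exact hb0.le
  have hN : (0 : ℝ) < #Lp := by exact_mod_cast hNpos
  -- (†) `(1−δ)² μ² |L_p| b ≤ A b − A |L_p|`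
  have hdag : (1 - δ) ^ 2 * μ ^ 2 * #Lp * b ≤ A * b - A * #Lp := by
    have e : A * (#Lp * (1 - #Lp / b)) = (A * b - A * #Lp) * #Lp / b := by field_simp
    rw [e, le_div_iff₀ hb0] at hmain
    have e2 : ((1 - δ) * μ * #Lp) ^ 2 * b = ((1 - δ) ^ 2 * μ ^ 2 * #Lp * b) * #Lp := by ring
    rw [e2] at hmain
    exact le_of_mul_le_mul_right hmain hN
  rcases hA0.eq_or_lt with hA00 | hApos
  · -- `A = 0`: then `(1−δ) μ = 0`, and `|L_p| ≤ b`
    rw [← hA00, zero_mul, zero_mul, sub_zero] at hdag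
    have h1 : (1 - δ) ^ 2 * μ ^ 2 * (#Lp * b) ≤ 0 * (#Lp * b) := by
      rw [zero_mul, ← mul_assoc]; exact hdag
    have h2 : (1 - δ) ^ 2 * μ ^ 2 ≤ 0 := le_of_mul_le_mul_right h1 (mul_pos hN hb0)
    have h3 : (1 - δ) ^ 2 * μ ^ 2 = 0 := le_antisymm h2 (by positivity)
    have h4 : μ * (1 - δ) ^ 2 = 0 := by
      rcases mul_eq_zero.1 h3 with h | h
      · rw [h, mul_zero]
      · rw [pow_eq_zero_iff two_ne_zero |>.1 h, zero_mul]
    rw [h4, add_zero, mul_one]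
    exact hLb
  · have h1 : (#Lp : ℝ) * A * μ * (1 - δ) ^ 2 ≤ (1 - δ) ^ 2 * μ ^ 2 * #Lp * b := by
      have h2 : 0 ≤ (#Lp : ℝ) * μ * (1 - δ) ^ 2 := by positivity
      calc (#Lp : ℝ) * A * μ * (1 - δ) ^ 2 = A * (#Lp * μ * (1 - δ) ^ 2) := by ring
        _ ≤ (μ * b) * (#Lp * μ * (1 - δ) ^ 2) := mul_le_mul_of_nonneg_right hμb h2
        _ = (1 - δ) ^ 2 * μ ^ 2 * #Lp * b := by ring
    have hkey : (#Lp : ℝ) * (1 + μ * (1 - δ) ^ 2) * A ≤ b * A := by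
      have e : (#Lp : ℝ) * (1 + μ * (1 - δ) ^ 2) * A = #Lp * A + #Lp * A * μ * (1 - δ) ^ 2 := by
        ring
      rw [e]; linarith
    exact le_of_mul_le_mul_right hkey hApos

/-- **Lemma 6 in the printed shape** (number of poor flats `≤ (1 + m q^{ℓ−n}(1−δ)²)⁻¹ q^{n−ℓ}[n choose ℓ]_q`).
Printed (with the ambient space written `𝔽_q^k`): "Let `S ⊂ 𝔽_q^k` be a set of `m` points. Let
`0 < δ < 1` and `1 ≤ ℓ ≤ k − 1`. The number of `(S, δ m q^{ℓ−k} + 1)`-poor `ℓ`-flats is at most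
`(1 + m q^{ℓ−k}(1−δ)²)^{−1} q^{k−ℓ} [k choose ℓ]_q`" (a flat is `(S, t)`-poor if it contains fewer
than `t` points of `S`).  CORRECTION, declared: "fewer than `δ m q^{ℓ−k} + 1` points" is formalised
as "at most `δ m q^{ℓ−k}` points" — the two agree when `δ m q^{ℓ−k}` is an integer, and for
non-integral `δ m q^{ℓ−k}` the printed bound is false as stated (e.g. `S = 𝔽_q²`, `ℓ = 1`,
`δ = 1 − 1/(2q)`: every one of the `q² + q` lines has `q < δ q + 1` points of `S`, while the printed
bound is `(q² + q)/(1 + 1/(4q)) < q² + q`); the application in Lemma 22 only uses flats with more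
than `δ m q^{−1}` points.  Here the ambient space is `𝔽_qⁿ`, `1 ≤ ℓ ≤ n`, `δ ≤ 1`.
[cite: DharDvirLund2021FurstenbergFiniteFields, Lemma 6 (p. 4)] -/
theorem card_poor_le {ℓ : ℕ} (hℓ : 1 ≤ ℓ) (hℓn : ℓ ≤ n) (S : Finset (Fin n → K))
    {δ : ℝ} (hδ1 : δ ≤ 1) :
    (#((kFlats K n ℓ).filter fun F => (#(S.filter fun x => x ∈ F) : ℝ) ≤
        δ * #S * (Fintype.card K : ℝ) ^ ((ℓ : ℤ) - n)) : ℝ) ≤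
      (1 + #S * (Fintype.card K : ℝ) ^ ((ℓ : ℤ) - n) * (1 - δ) ^ 2)⁻¹ *
        ((Fintype.card K : ℝ) ^ (n - ℓ) * qBinomial (Fintype.card K : ℝ) n ℓ) := by
  have hq0 : (Fintype.card K : ℝ) ≠ 0 := Nat.cast_ne_zero.2 Fintype.card_ne_zero
  have hz : (Fintype.card K : ℝ) ^ ((ℓ : ℤ) - n) =
      (Fintype.card K : ℝ) ^ ℓ / (Fintype.card K : ℝ) ^ n := by
    rw [zpow_sub₀ hq0, zpow_natCast, zpow_natCast]
  rw [hz]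
  have h := card_mul_le_of_poor hℓ hℓn S hδ1 (Lp := (kFlats K n ℓ).filter fun F =>
      (#(S.filter fun x => x ∈ F) : ℝ) ≤
        δ * #S * ((Fintype.card K : ℝ) ^ ℓ / (Fintype.card K : ℝ) ^ n))
    (filter_subset _ _) (fun F hF => by
      have := (mem_filter.1 hF).2
      rw [mul_assoc, ← mul_div_assoc] at this
      exact this)
  rw [show (#S : ℝ) * ((Fintype.card K : ℝ) ^ ℓ / (Fintype.card K : ℝ) ^ n) =
      #S * (Fintype.card K : ℝ) ^ ℓ / (Fintype.card K : ℝ) ^ n by ring]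
  have hpos : (0 : ℝ) < 1 + #S * (Fintype.card K : ℝ) ^ ℓ / (Fintype.card K : ℝ) ^ n * (1 - δ) ^ 2 := by
    positivity
  rw [inv_mul_eq_div, le_div_iff₀ hpos]
  exact h

end PoorFlats

/-! ### §7: Lemma 21 — the flats witnessing a Furstenberg set contain many lower-dimensional flats -/

section KakeyaForFlats

variable {n : ℕ} [Fintype K]

/-- The direction of a flat `C`: the span of the differences of its points (for `C = W + x` this
is `W`, `direction_translate`). [cite: DharDvirLund2021FurstenbergFiniteFields, §2.1 (pp. 3–4)] -/
noncomputable def direction (C : Finset (Fin n → K)) : Submodule K (Fin n → K) :=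
  Submodule.span K {v | ∃ a ∈ C, ∃ b ∈ C, v = a - b}

/-- The direction of `W + x` is `W`. [cite: DharDvirLund2021FurstenbergFiniteFields, §2.1 (pp. 3–4)] -/
theorem direction_translate (W : Submodule K (Fin n → K)) (x : Fin n → K) :
    direction (translate W x) = W := by
  apply le_antisymm
  · rw [direction, Submodule.span_le]
    rintro v ⟨a, ha, b, hb, rfl⟩
    have h := W.sub_mem (mem_translate.1 ha) (mem_translate.1 hb)
    rwa [sub_sub_sub_cancel_right] at h
  · intro w hw
    refine Submodule.subset_span ⟨x + w, ?_, x, self_mem_translate W x, ?_⟩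
    · rw [mem_translate, add_sub_cancel_left]; exact hw
    · rw [add_sub_cancel_left]

omit [Fintype K] in
/-- For an onto linear map `π`, `dim π⁻¹(W′) = dim W′ + dim ker π`. [folklore] -/
private theorem finrank_comap_of_surjective {V₂ : Type*} [AddCommGroup V₂] [Module K V₂]
    [FiniteDimensional K V₂] {π : (Fin n → K) →ₗ[K] V₂} (hπ : Function.Surjective π)
    (W' : Submodule K V₂) :
    finrank K (W'.comap π) = finrank K W' + finrank K (LinearMap.ker π) := by
  have h1 := (π.domRestrict (W'.comap π)).finrank_range_add_finrank_ker
  rw [LinearMap.range_domRestrict, Submodule.map_comap_eq_of_surjective hπ,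
    LinearMap.ker_domRestrict] at h1
  rw [← h1, (Submodule.comapSubtypeEquivOfLe (LinearMap.ker_le_comap (p := W') π)).finrank_eq]

variable [DecidableEq K]

/-- **Lemma 21.** "Let `F` be a set of `k`-flats in `𝔽_qⁿ`, one parallel to each rank `k`
subspace, with `2 ≤ k < n`. Let `1 ≤ ℓ < k`. The number of `ℓ`-flats contained in the flats of `F`
is at least `[n choose ℓ]_q K(q, n − ℓ, k − ℓ, q^{k−ℓ})`."  (`F` is asked to contain a flat parallel to
each rank-`k` subspace; the statement holds, and is proved, for all `0 ≤ ℓ < k < n`.)  Proof as printed, with the complement `P_Λ` of a rank-`ℓ` subspace `Λ`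
replaced by the (isomorphic) quotient `𝔽_qⁿ/Λ ≅ 𝔽_q^{n−ℓ}` (an onto linear `π` with `ker π = Λ`):
the `ℓ`-flats parallel to `Λ` inside flats of `F` correspond to the points of
`K_Λ = {π(x) : Λ + x ⊆ some flat of F}`, which is `(k − ℓ, q^{k−ℓ})`-Furstenberg in `𝔽_q^{n−ℓ}` (a
rank-`(k−ℓ)` subspace `H` of `𝔽_q^{n−ℓ}` is `π(Γ)` for the rank-`k` subspace `Γ = π⁻¹(H) ⊇ Λ`, and
the flat `Γ + v ∈ F` gives `H + π(v) ⊆ K_Λ`); summing over the `[n choose ℓ]_q` subspaces `Λ`.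
[cite: DharDvirLund2021FurstenbergFiniteFields, Lemma 21 (pp. 11–12)] -/
theorem qBinomial_mul_furstenbergNumber_le_card {k ℓ : ℕ} (hℓk : ℓ < k) (hkn : k < n)
    {F : Finset (Finset (Fin n → K))}
    (hF : ∀ W : Submodule K (Fin n → K), finrank K W = k → ∃ x, translate W x ∈ F) :
    qBinomial (Fintype.card K : ℝ) n ℓ *
        (furstenbergNumber K (n - ℓ) (k - ℓ) (Fintype.card K ^ (k - ℓ)) : ℝ) ≤
      #((kFlats K n ℓ).filter fun C => ∃ B ∈ F, C ⊆ B) := by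
  classical
  set G := (kFlats K n ℓ).filter fun C => ∃ B ∈ F, C ⊆ B with hG
  set t : Finset (Submodule K (Fin n → K)) := univ.filter fun W => finrank K W = ℓ with ht
  have hmap : ∀ C ∈ G, direction C ∈ t := by
    intro C hC
    obtain ⟨W, hW, x, rfl⟩ := mem_kFlats.1 (mem_filter.1 hC).1
    rw [ht, mem_filter, direction_translate]
    exact ⟨mem_univ _, hW⟩
  -- each direction class has at least `K(q, n−ℓ, k−ℓ, q^{k−ℓ})` flats
  have hfib : ∀ Λ ∈ t, furstenbergNumber K (n - ℓ) (k - ℓ) (Fintype.card K ^ (k - ℓ)) ≤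
      #(G.filter fun C => direction C = Λ) := by
    intro Λ hΛ
    have hΛℓ : finrank K Λ = ℓ := (mem_filter.1 hΛ).2
    -- the quotient map `π : 𝔽_qⁿ → 𝔽_q^{n−ℓ}`, `ker π = Λ`
    obtain ⟨π, hπ, hker⟩ := exists_linearMap_ker_eq (K := K) (V₂ := Fin (n - ℓ) → K) Λ
      (by rw [hΛℓ, Module.finrank_fintype_fun_eq_card, Fintype.card_fin]; omega)
    set KΛ : Finset (Fin (n - ℓ) → K) := univ.filter fun z =>
      ∃ x, π x = z ∧ ∃ B ∈ F, translate Λ x ⊆ B with hKΛ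
    -- `K_Λ` is `(k−ℓ, q^{k−ℓ})`-Furstenberg
    have hKF : IsFurstenberg (k - ℓ) (Fintype.card K ^ (k - ℓ)) (KΛ : Set (Fin (n - ℓ) → K)) := by
      intro W' hW'
      have hΓ : finrank K (W'.comap π) = k := by
        rw [finrank_comap_of_surjective hπ, hW', hker, hΛℓ]; omega
      obtain ⟨y, hy⟩ := hF (W'.comap π) hΓ
      refine ⟨π y, ?_⟩
      have hsub : ((translate W' (π y) : Finset (Fin (n - ℓ) → K)) : Set (Fin (n - ℓ) → K)) ⊆
          {z ∈ (KΛ : Set (Fin (n - ℓ) → K)) | z - π y ∈ W'} := by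
        intro z hz
        have hz' : z - π y ∈ W' := mem_translate.1 hz
        refine ⟨?_, hz'⟩
        rw [mem_coe, hKΛ, mem_filter]
        obtain ⟨x, rfl⟩ := hπ z
        refine ⟨mem_univ _, x, rfl, translate (W'.comap π) y, hy, fun u hu => ?_⟩
        rw [mem_translate] at hu ⊢
        have hxy : x - y ∈ W'.comap π := by
          rw [Submodule.mem_comap, map_sub]; exact hz'
        have hux : u - x ∈ W'.comap π := by
          rw [← hker] at hu; exact LinearMap.ker_le_comap π hu
        have := (W'.comap π).add_mem hux hxy
        rwa [sub_add_sub_cancel] at this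
      calc Fintype.card K ^ (k - ℓ) = #(translate W' (π y)) := by rw [card_translate, hW']
        _ = ((translate W' (π y) : Finset _) : Set (Fin (n - ℓ) → K)).ncard :=
          (Set.ncard_coe_finset _).symm
        _ ≤ _ := Set.ncard_le_ncard hsub (Set.toFinite _)
    have h1 := furstenbergNumber_le_card KΛ hKF
    -- `K_Λ` injects into the direction class of `Λ`
    have h2 : #KΛ ≤ #(G.filter fun C => direction C = Λ) := by
      refine Finset.card_le_card_of_injOn (fun z => translate Λ (Function.surjInv hπ z))
        (fun z hz => ?_) (fun z hz z' hz' hzz => ?_)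
      · dsimp only
        obtain ⟨-, x, hxz, B, hB, hxB⟩ := mem_filter.1 hz
        have hxx : translate Λ (Function.surjInv hπ z) = translate Λ x := by
          apply translate_eq_translate_of_mem
          rw [← hker, LinearMap.mem_ker, map_sub, Function.surjInv_eq hπ z, hxz, sub_self]
        rw [mem_coe, mem_filter, hG, mem_filter, hxx, direction_translate]
        exact ⟨⟨translate_mem_kFlats hΛℓ x, B, hB, hxB⟩, rfl⟩
      · dsimp only at hzz
        have hmem : Function.surjInv hπ z' ∈ translate Λ (Function.surjInv hπ z) := by
          rw [hzz]; exact self_mem_translate _ _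
        rw [mem_translate, ← hker, LinearMap.mem_ker, map_sub, Function.surjInv_eq hπ,
          Function.surjInv_eq hπ, sub_eq_zero] at hmem
        exact hmem.symm
    exact h1.trans h2
  -- sum over the `[n choose ℓ]_q` directions
  have hsum : #G = ∑ Λ ∈ t, #(G.filter fun C => direction C = Λ) :=
    card_eq_sum_card_fiberwise hmap
  have ht_card : (#t : ℝ) = qBinomial (Fintype.card K : ℝ) n ℓ := by
    have h1 : #t = Fintype.card {W : Submodule K (Fin n → K) // finrank K W = ℓ} :=
      (Fintype.card_subtype _).symm
    have h2 := card_subspaces_eq_qBinomial n ℓ (K := K)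
    have h3 := cast_qBinomial (Fintype.card K : ℤ) n ℓ
    push_cast at h3
    rw [h1, ← h3]
    exact_mod_cast h2
  rw [hsum, ← ht_card]
  push_cast
  calc (#t : ℝ) * (furstenbergNumber K (n - ℓ) (k - ℓ) (Fintype.card K ^ (k - ℓ)) : ℝ)
      = ∑ Λ ∈ t, (furstenbergNumber K (n - ℓ) (k - ℓ) (Fintype.card K ^ (k - ℓ)) : ℝ) := by
        rw [sum_const, nsmul_eq_mul]
    _ ≤ ∑ Λ ∈ t, (#(G.filter fun C => direction C = Λ) : ℝ) :=
        sum_le_sum fun Λ hΛ => by exact_mod_cast hfib Λ hΛ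

end KakeyaForFlats

/-! ### §7: flats inside a `k`-flat (transport to `𝔽_q^k`), and Lemma 22 -/

section Subflats

variable {n k : ℕ} [Fintype K]

/-- Transport of flats along an affine embedding `z ↦ y + ψ(z)`, `ψ : 𝔽_q^k → 𝔽_qⁿ` linear:
the image of the flat `H + x′` is the flat `ψ(H) + (y + ψ x′)`. [folklore] -/
private theorem image_translate [DecidableEq K] (ψ : (Fin k → K) →ₗ[K] (Fin n → K)) (y : Fin n → K)
    (H : Submodule K (Fin k → K)) (x' : Fin k → K) :
    (translate H x').image (fun z => y + ψ z) = translate (H.map ψ) (y + ψ x') := by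
  ext v
  simp only [mem_image, mem_translate, Submodule.mem_map]
  constructor
  · rintro ⟨z, hz, rfl⟩
    exact ⟨z - x', hz, by rw [map_sub]; abel⟩
  · rintro ⟨h, hh, hv⟩
    refine ⟨x' + h, by rwa [add_sub_cancel_left], ?_⟩
    rw [map_add]
    rw [hv]; abel

omit [Fintype K] in
/-- An injective linear map preserves the rank of a subspace. [folklore] -/
private theorem finrank_map_of_injective {ψ : (Fin k → K) →ₗ[K] (Fin n → K)}
    (hψ : Function.Injective ψ) (H : Submodule K (Fin k → K)) :
    finrank K (H.map ψ) = finrank K H :=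
  (Submodule.equivMapOfInjective ψ hψ H).finrank_eq.symm

/-- Every `ℓ`-flat contained in the `k`-flat `Γ + y = {y + ψ z}` (`ψ : 𝔽_q^k ≅ Γ`) is the image of
an `ℓ`-flat of `𝔽_q^k`. [folklore] -/
private theorem exists_eq_image_of_subset_translate [DecidableEq K] {ℓ : ℕ}
    {ψ : (Fin k → K) →ₗ[K] (Fin n → K)} (hψ : Function.Injective ψ) {Γ : Submodule K (Fin n → K)}
    (hψΓ : LinearMap.range ψ = Γ) (y : Fin n → K) {C : Finset (Fin n → K)}
    (hC : C ∈ kFlats K n ℓ) (hCB : C ⊆ translate Γ y) :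
    ∃ H : Submodule K (Fin k → K), finrank K H = ℓ ∧
      ∃ x' : Fin k → K, C = (translate H x').image (fun z => y + ψ z) := by
  obtain ⟨H', hH', x, rfl⟩ := mem_kFlats.1 hC
  have hx : x - y ∈ Γ := mem_translate.1 (hCB (self_mem_translate H' x))
  have hH'Γ : H' ≤ Γ := by
    intro h hh
    have h1 : x + h - y ∈ Γ := by
      refine mem_translate.1 (hCB ?_)
      rw [mem_translate, add_sub_cancel_left]; exact hh
    have := Γ.sub_mem h1 hx
    rwa [sub_sub_sub_cancel_right, add_sub_cancel_left] at this
  rw [← hψΓ] at hx hH'Γ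
  obtain ⟨x', hx'⟩ := LinearMap.mem_range.1 hx
  refine ⟨H'.comap ψ, ?_, x', ?_⟩
  · have hmap : (H'.comap ψ).map ψ = H' := by
      rw [Submodule.map_comap_eq, inf_eq_right.2 hH'Γ]
    rw [← finrank_map_of_injective hψ, hmap, hH']
  · rw [image_translate, Submodule.map_comap_eq, inf_eq_right.2 hH'Γ, hx', add_sub_cancel]

omit [Field K] in
/-- Counting points of `S` on a transported set: `|S ∩ φ(C′)| = |φ⁻¹(S) ∩ C′|` for injective `φ`.
[folklore] -/
private theorem card_filter_mem_image [DecidableEq K] {φ : (Fin k → K) → (Fin n → K)}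
    (hφ : Function.Injective φ) (S : Finset (Fin n → K)) (C' : Finset (Fin k → K)) :
    #(S.filter fun v => v ∈ C'.image φ) =
      #((univ.filter fun z => φ z ∈ S).filter fun z => z ∈ C') := by
  rw [← card_image_of_injective ((univ.filter fun z => φ z ∈ S).filter fun z => z ∈ C') hφ]
  congr 1
  ext v
  simp only [mem_filter, mem_image, mem_univ, true_and]
  constructor
  · rintro ⟨hvS, z, hz, rfl⟩
    exact ⟨z, ⟨hvS, hz⟩, rfl⟩
  · rintro ⟨z, ⟨hzS, hz⟩, rfl⟩
    exact ⟨hzS, z, hz, rfl⟩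

/-- The `k`-flat `Γ + y` is the image of `𝔽_q^k` under `z ↦ y + ψ z` (`ψ : 𝔽_q^k ≅ Γ`). [folklore] -/
private theorem translate_eq_image_univ [DecidableEq K] {ψ : (Fin k → K) →ₗ[K] (Fin n → K)}
    {Γ : Submodule K (Fin n → K)} (hψΓ : LinearMap.range ψ = Γ) (y : Fin n → K) :
    translate Γ y = (univ : Finset (Fin k → K)).image (fun z => y + ψ z) := by
  ext v
  simp only [mem_translate, mem_image, mem_univ, true_and, ← hψΓ, LinearMap.mem_range]
  constructor
  · rintro ⟨z, hz⟩; exact ⟨z, by rw [hz]; abel⟩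
  · rintro ⟨z, rfl⟩; exact ⟨z, by abel⟩

/-- Monotonicity used in Lemma 22: `t ↦ (t − c)²/t` is increasing for `t ≥ |c|`, in the form
`m (1 − δ)² ≤ m′ (1 − δ m/m′)²` for `1 ≤ m ≤ m′`, `|δ| ≤ 1`. [folklore] -/
private theorem mul_sq_le_mul_sq {m m' δ : ℝ} (hm : 1 ≤ m) (hmm : m ≤ m') (hδ0 : -1 ≤ δ) (hδ1 : δ ≤ 1) :
    m * (1 - δ) ^ 2 ≤ m' * (1 - δ * m / m') ^ 2 := by
  have hm' : 0 < m' := by linarith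
  have e : m' * (1 - δ * m / m') ^ 2 = (m' - δ * m) ^ 2 / m' := by
    field_simp
  rw [e, le_div_iff₀ hm']
  have key : (m' - δ * m) ^ 2 - m * (1 - δ) ^ 2 * m' = (m' - m) * (m' - δ ^ 2 * m) := by ring
  have hδsq : δ ^ 2 ≤ 1 := by nlinarith
  have h1 : 0 ≤ m' - δ ^ 2 * m := by nlinarith
  have h2 : 0 ≤ (m' - m) * (m' - δ ^ 2 * m) := mul_nonneg (by linarith) h1
  linarith

variable [DecidableEq K]

/-- **The per-flat step of Lemma 22** ("Applying Lemma 6, the number of `(S, r)`-poor `(k−1)`-flats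
contained in any given `k`-flat is at most `(1 + m q^{−1}(1−δ)²)^{−1} q (1 − q^k)(1 − q)^{−1}`"):
if the `k`-flat `Γ + y` (`2 ≤ k`) contains at least `m ≥ 1` points of `S` and `δ ≤ 1`, then the
`(k−1)`-flats inside `Γ + y` with at most `δ m q^{−1}` points of `S` number `N` with
`N (1 + m (1−δ)²/q) ≤ q [k choose k−1]_q` (`= q(q^k − 1)/(q − 1)`).  Proof: transport `Γ + y ≅ 𝔽_q^k`
and apply Lemma 6 (`card_mul_le_of_poor`) there with `δ′ = δ m/m′`, `m′ = |S ∩ (Γ + y)|`.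
[cite: DharDvirLund2021FurstenbergFiniteFields, Lemma 22 (proof, pp. 12–13)] -/
theorem card_poor_subflats_mul_le {m : ℕ} (hk : 2 ≤ k) (hm : 1 ≤ m)
    {δ : ℝ} (hδ1 : δ ≤ 1) (S : Finset (Fin n → K)) {Γ : Submodule K (Fin n → K)}
    (hΓ : finrank K Γ = k) (y : Fin n → K) (hrich : m ≤ #(S.filter fun x => x ∈ translate Γ y)) :
    (#((kFlats K n (k - 1)).filter fun C => C ⊆ translate Γ y ∧
        (#(S.filter fun x => x ∈ C) : ℝ) ≤ δ * m / (Fintype.card K : ℝ)) : ℝ) *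
      (1 + m * (1 - δ) ^ 2 / (Fintype.card K : ℝ)) ≤
      (Fintype.card K : ℝ) * qBinomial (Fintype.card K : ℝ) k (k - 1) := by
  set qR : ℝ := (Fintype.card K : ℝ) with hqR
  have hq : (0 : ℝ) < qR := Nat.cast_pos.2 Fintype.card_pos
  set Lp := (kFlats K n (k - 1)).filter fun C => C ⊆ translate Γ y ∧
      (#(S.filter fun x => x ∈ C) : ℝ) ≤ δ * m / qR with hLp
  have hB1 : 1 ≤ qBinomial qR k (k - 1) := one_le_qBinomial hq.le (Nat.sub_le k 1)
  -- negative `δ`: no poor flats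
  rcases lt_or_ge δ (-1) with hδneg | hδ0
  · have hempty : Lp = ∅ := by
      rw [hLp, filter_eq_empty_iff]
      rintro C - ⟨-, hC⟩
      have h0 : (0 : ℝ) ≤ #(S.filter fun x => x ∈ C) := Nat.cast_nonneg _
      have h1 : δ * m / qR < 0 := by
        apply div_neg_of_neg_of_pos _ hq
        have : (1 : ℝ) ≤ m := by exact_mod_cast hm
        nlinarith
      linarith
    rw [hempty, card_empty, Nat.cast_zero, zero_mul]
    positivity
  -- transport `Γ + y ≅ 𝔽_q^k`
  obtain ⟨ψ, hψ, hψΓ⟩ : ∃ ψ : (Fin k → K) →ₗ[K] (Fin n → K),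
      Function.Injective ψ ∧ LinearMap.range ψ = Γ := by
    let e : (Fin k → K) ≃ₗ[K] Γ := (Module.finBasisOfFinrankEq K Γ hΓ).equivFun.symm
    refine ⟨Γ.subtype ∘ₗ e.toLinearMap, Γ.subtype_injective.comp e.injective, ?_⟩
    rw [LinearMap.range_comp, LinearEquiv.range, Submodule.map_top, Submodule.range_subtype]
  obtain ⟨φ, hφdef⟩ : ∃ φ : (Fin k → K) → (Fin n → K), φ = fun z => y + ψ z := ⟨_, rfl⟩
  have hφ : Function.Injective φ := by
    rw [hφdef]; exact fun a b h => hψ (add_left_cancel h)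
  obtain ⟨S', hS'⟩ : ∃ S' : Finset (Fin k → K), S' = univ.filter fun z => φ z ∈ S := ⟨_, rfl⟩
  have hS'card : #S' = #(S.filter fun x => x ∈ translate Γ y) := by
    rw [translate_eq_image_univ hψΓ y, ← hφdef, card_filter_mem_image hφ S univ, hS']
    congr 1; ext z; simp
  have hm' : m ≤ #S' := hS'card ▸ hrich
  have hm'pos : (0 : ℝ) < #S' := by
    have : (1 : ℝ) ≤ m := by exact_mod_cast hm
    have : (m : ℝ) ≤ #S' := by exact_mod_cast hm'
    linarith
  -- the poor `(k−1)`-flats of `𝔽_q^k` whose image is poor in `Γ + y`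
  obtain ⟨Lp', hLp'⟩ : ∃ Lp' : Finset (Finset (Fin k → K)),
      Lp' = (kFlats K k (k - 1)).filter fun C' => C'.image φ ∈ Lp := ⟨_, rfl⟩
  have hLpLp' : Lp = Lp'.image fun C' => C'.image φ := by
    ext C
    rw [mem_image]
    constructor
    · intro hC
      have hC' := hC
      rw [hLp, mem_filter] at hC'
      obtain ⟨H, hH, x', rfl⟩ := exists_eq_image_of_subset_translate hψ hψΓ y hC'.1 hC'.2.1
      refine ⟨translate H x', ?_, by rw [hφdef]⟩
      rw [hLp', mem_filter, hφdef]
      exact ⟨translate_mem_kFlats hH x', hC⟩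
    · rintro ⟨C', hC', rfl⟩
      rw [hLp', mem_filter] at hC'
      exact hC'.2
  have hcard : #Lp = #Lp' := by
    rw [hLpLp', card_image_of_injective]
    intro C₁ C₂ h
    exact Finset.image_injective hφ h
  -- Lemma 6 in `𝔽_q^k` with `δ′ = δ m / m′`
  have hk1 : 1 ≤ k - 1 := by omega
  have hδ' : δ * m / #S' ≤ 1 := by
    rw [div_le_one hm'pos]
    have : (m : ℝ) ≤ #S' := by exact_mod_cast hm'
    have : (0 : ℝ) ≤ m := Nat.cast_nonneg _
    nlinarith
  have hpoor' : ∀ C' ∈ Lp', (#(S'.filter fun z => z ∈ C') : ℝ) ≤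
      δ * m / #S' * (#S' * qR ^ (k - 1) / qR ^ k) := by
    intro C' hC'
    rw [hLp', mem_filter] at hC'
    obtain ⟨-, hC'Lp⟩ := hC'
    rw [hLp, mem_filter] at hC'Lp
    have h1 := hC'Lp.2.2
    rw [card_filter_mem_image hφ S C', ← hS'] at h1
    have e : δ * m / #S' * (#S' * qR ^ (k - 1) / qR ^ k) = δ * m / qR := by
      have hqk : qR ^ k = qR ^ (k - 1) * qR := by
        rw [← pow_succ, Nat.sub_add_cancel (by omega)]
      obtain ⟨a, ha⟩ : ∃ a : ℝ, a = qR ^ (k - 1) := ⟨_, rfl⟩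
      have ha0 : 0 < a := by rw [ha]; positivity
      rw [hqk, ← ha, div_mul_div_comm,
        div_eq_div_iff (mul_ne_zero hm'pos.ne' (mul_ne_zero ha0.ne' hq.ne')) hq.ne']
      ring
    rw [e]; exact h1
  have hLp'sub : Lp' ⊆ kFlats K k (k - 1) := by rw [hLp']; exact filter_subset _ _
  have h6 := card_mul_le_of_poor hk1 (Nat.sub_le k 1) S' hδ' hLp'sub hpoor'
  rw [Nat.sub_sub_self (by omega : 1 ≤ k), pow_one] at h6
  -- compare the two correction factors
  have hmono : (1 : ℝ) + m * (1 - δ) ^ 2 / qR ≤ 1 + #S' * qR ^ (k - 1) / qR ^ k * (1 - δ * m / #S') ^ 2 := by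
    have hqk : qR ^ k = qR ^ (k - 1) * qR := by
      rw [← pow_succ, Nat.sub_add_cancel (by omega)]
    have e : (#S' : ℝ) * qR ^ (k - 1) / qR ^ k * (1 - δ * m / #S') ^ 2 =
        #S' * (1 - δ * m / #S') ^ 2 / qR := by
      obtain ⟨a, ha⟩ : ∃ a : ℝ, a = qR ^ (k - 1) := ⟨_, rfl⟩
      have ha0 : 0 < a := by rw [ha]; positivity
      rw [hqk, ← ha, mul_comm a qR, mul_div_mul_right _ _ ha0.ne']
      ring
    rw [e, add_le_add_iff_left, div_le_div_iff_of_pos_right hq]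
    exact mul_sq_le_mul_sq (by exact_mod_cast hm) (by exact_mod_cast hm') hδ0 hδ1
  calc (#Lp : ℝ) * (1 + m * (1 - δ) ^ 2 / qR)
      ≤ #Lp' * (1 + #S' * qR ^ (k - 1) / qR ^ k * (1 - δ * m / #S') ^ 2) := by
        rw [hcard]; exact mul_le_mul_of_nonneg_left hmono (Nat.cast_nonneg _)
    _ ≤ qR * qBinomial qR k (k - 1) := h6

end Subflats

section LargeM

variable {n : ℕ} [Fintype K] [DecidableEq K]

/-- **Lemma 22.** "Let `2 ≤ k < n`. Let `S` be a `(k, m)`-Furstenberg set in `𝔽_qⁿ`. Let `δ < 1`. Let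
`G_r` be the set of `(k−1)`-flats that are each incident to at least `r = δ m q^{−1} + 1` points of
`S`. If `m ≥ 2^{n+3−k} q (1 − δ)^{−2}`, then `|G_r| > 2^{k−2−n} q^{n−k+1} [n choose k−1]_q`."
DEVIATION, declared (see Lemma 6): "at least `δ m q^{−1} + 1` points" is formalised as "more than
`δ m q^{−1}` points" (equivalent for integral `δ m q^{−1}`; this is the set the printed proof
controls — the complement of the `(S, r)`-poor flats in the corrected reading — and the one used in
the proof of Theorem 2).  Proof as printed: `F` = one rich `k`-flat per direction, `G` = the
`(k−1)`-flats inside flats of `F`, `|G| ≥ [n choose k−1]_q K(q, n−k+1, 1, q) ≥ 2^{k−1−n} q^{n−k+1} [n choose k−1]_q`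
(Lemma 21 and (1)); the poor flats of `G` number
`< 2^{k−3−n} |F| q [k choose k−1]_q = 2^{k−3−n} [n choose k−1]_q q [n−k+1 choose 1]_q < 2^{k−2−n} [n choose k−1]_q q^{n−k+1} ≤ |G|/2`
(Lemma 6 in each flat of `F`, the exact expression (9) in the form
`(1 − q^k)[n choose k]_q = (1 − q^{n−k+1})[n choose k−1]_q`).
[cite: DharDvirLund2021FurstenbergFiniteFields, Lemma 22 (pp. 12–13)] -/
theorem lt_card_rich_subflats {k m : ℕ} (hk : 2 ≤ k) (hkn : k < n) (S : Finset (Fin n → K))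
    (hS : IsFurstenberg k m (S : Set (Fin n → K))) {δ : ℝ} (hδ : δ < 1)
    (hm : (2 : ℝ) ^ (n + 3 - k) * (Fintype.card K : ℝ) / (1 - δ) ^ 2 ≤ m) :
    (2 : ℝ) ^ ((k : ℤ) - 2 - n) * (Fintype.card K : ℝ) ^ (n - k + 1) *
        qBinomial (Fintype.card K : ℝ) n (k - 1) <
      #((kFlats K n (k - 1)).filter fun C =>
        δ * m / (Fintype.card K : ℝ) < #(S.filter fun x => x ∈ C)) := by
  classical
  set qR : ℝ := (Fintype.card K : ℝ) with hqR
  have hq : (0 : ℝ) < qR := Nat.cast_pos.2 Fintype.card_pos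
  have hq2 : (2 : ℝ) ≤ qR := by
    have := Fintype.one_lt_card (α := K)
    rw [hqR]; exact_mod_cast this
  -- `2^{k−2−n} = 1/a`, `a = 2^{n+2−k}`
  obtain ⟨a, ha⟩ : ∃ a : ℝ, a = (2 : ℝ) ^ (n + 2 - k) := ⟨_, rfl⟩
  have ha0 : 0 < a := by rw [ha]; positivity
  have hγ : (2 : ℝ) ^ ((k : ℤ) - 2 - n) = a⁻¹ := by
    rw [ha, ← zpow_natCast, ← zpow_neg]
    congr 1
    push_cast [Nat.cast_sub (show k ≤ n + 2 by omega)]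
    ring
  rw [hγ]
  -- `m ≥ 1`, `(1 − δ)² m / q ≥ 2^{n+3−k} = 2a`
  have h1δ : 0 < 1 - δ := by linarith
  have hmq : 2 * a ≤ m * (1 - δ) ^ 2 / qR := by
    rw [div_le_iff₀ (pow_pos h1δ 2), show n + 3 - k = n + 2 - k + 1 by omega, pow_succ, ← ha] at hm
    rw [le_div_iff₀ hq]
    linarith
  have hm1 : 1 ≤ m := by
    have h1 : (0 : ℝ) < m * (1 - δ) ^ 2 / qR := lt_of_lt_of_le (by positivity) hmq
    have h2 : (0 : ℝ) < m := by
      by_contra h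
      push Not at h
      have : (m : ℝ) * (1 - δ) ^ 2 / qR ≤ 0 :=
        div_nonpos_of_nonpos_of_nonneg (mul_nonpos_of_nonpos_of_nonneg h (sq_nonneg _)) hq.le
      linarith
    exact_mod_cast (show (0 : ℝ) < m from h2)
  -- `F`: one rich `k`-flat per direction
  have hch : ∀ W : {W : Submodule K (Fin n → K) // finrank K W = k},
      ∃ x : Fin n → K, m ≤ #(S.filter fun y => y ∈ translate W.1 x) := by
    intro W
    obtain ⟨x, hx⟩ := hS W.1 W.2
    exact ⟨x, by rwa [card_filter_mem_translate]⟩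
  choose x hx using hch
  have hinj : Function.Injective
      (fun W : {W : Submodule K (Fin n → K) // finrank K W = k} => translate W.1 (x W)) :=
    fun W W' h => Subtype.ext (eq_of_translate_eq h)
  set F : Finset (Finset (Fin n → K)) := univ.image fun W => translate W.1 (x W) with hF
  have hFdir : ∀ W : Submodule K (Fin n → K), finrank K W = k → ∃ z, translate W z ∈ F :=
    fun W hW => ⟨x ⟨W, hW⟩, mem_image.2 ⟨⟨W, hW⟩, mem_univ _, rfl⟩⟩
  have hFcard : (#F : ℝ) = qBinomial qR n k := by
    rw [hF, card_image_of_injective _ hinj, card_univ]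
    have h1 := card_subspaces_eq_qBinomial n k (K := K)
    have h2 := cast_qBinomial (Fintype.card K : ℤ) n k
    push_cast at h2
    rw [← h2]; exact_mod_cast h1
  -- `G`: the `(k−1)`-flats inside flats of `F`; Lemma 21 and (1)
  set G := (kFlats K n (k - 1)).filter fun C => ∃ B ∈ F, C ⊆ B with hG
  have h21 := qBinomial_mul_furstenbergNumber_le_card (K := K) (show k - 1 < k by omega) hkn hFdir
  rw [show n - (k - 1) = n - k + 1 by omega, show k - (k - 1) = 1 by omega, pow_one] at h21
  have hK1 := div_two_pow_le_furstenbergNumber_one (K := K) (n := n - k + 1) (by omega)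
  have hBk1 : 0 ≤ qBinomial qR n (k - 1) := qBinomial_nonneg hq.le _ _
  have hGge : qBinomial qR n (k - 1) * (qR / 2) ^ (n - k + 1) ≤ #G :=
    (mul_le_mul_of_nonneg_left hK1 hBk1).trans h21
  -- the poor flats of `G`
  set Gp := G.filter fun C => (#(S.filter fun x => x ∈ C) : ℝ) ≤ δ * m / qR with hGp
  have hB1k : 1 ≤ qBinomial qR k (k - 1) := one_le_qBinomial hq.le (Nat.sub_le k 1)
  have hGp_le : (#Gp : ℝ) * (1 + m * (1 - δ) ^ 2 / qR) ≤ #F * (qR * qBinomial qR k (k - 1)) := by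
    -- `G_p` is covered by the poor sub-flats of the flats of `F`
    have hcover : Gp ⊆ F.biUnion fun B => (kFlats K n (k - 1)).filter fun C =>
        C ⊆ B ∧ (#(S.filter fun x => x ∈ C) : ℝ) ≤ δ * m / qR := by
      intro C hC
      rw [hGp, mem_filter, hG, mem_filter] at hC
      obtain ⟨⟨hCk, B, hB, hCB⟩, hpoor⟩ := hC
      exact mem_biUnion.2 ⟨B, hB, mem_filter.2 ⟨hCk, hCB, hpoor⟩⟩
    have h1 : (#Gp : ℝ) ≤ ∑ B ∈ F, (#((kFlats K n (k - 1)).filter fun C =>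
        C ⊆ B ∧ (#(S.filter fun x => x ∈ C) : ℝ) ≤ δ * m / qR) : ℝ) := by
      have := (card_le_card hcover).trans card_biUnion_le
      exact_mod_cast this
    have h2 : ∀ B ∈ F, (#((kFlats K n (k - 1)).filter fun C =>
        C ⊆ B ∧ (#(S.filter fun x => x ∈ C) : ℝ) ≤ δ * m / qR) : ℝ) * (1 + m * (1 - δ) ^ 2 / qR) ≤
        qR * qBinomial qR k (k - 1) := by
      intro B hB
      rw [hF, mem_image] at hB
      obtain ⟨W, -, rfl⟩ := hB
      exact card_poor_subflats_mul_le hk hm1 hδ.le S W.2 (x W) (hx W)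
    have h3 := sum_le_sum h2
    rw [← sum_mul, sum_const, nsmul_eq_mul] at h3
    exact (mul_le_mul_of_nonneg_right h1 (by positivity)).trans h3
  -- `|F| q [k choose k−1]_q = [n choose k−1]_q q [n−k+1 choose 1]_q ≤ [n choose k−1]_q · 2 (q^{n−k+1} − 1)`
  -- via (9) in the form `(1 − q^k)[n choose k]_q = (1 − q^{n−k+1})[n choose k−1]_q` and
  -- `[k choose k−1]_q (q − 1) = q^k − 1`
  have hkey := Literature.Combinatorics.Enumerative.qBinomial_key qR (k - 1) (n - k)
  rw [show k - 1 + (n - k) + 1 = n by omega, show n - k + 1 = n - (k - 1) by omega,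
    show k - 1 + 1 = k by omega] at hkey
  -- `[k choose k−1]_q (q − 1) = q^k − 1` (from `[k choose k−1]_q = q^{k−1} + [k−1 choose k−2]_q`)
  have hgeom : ∀ j : ℕ, 1 ≤ j → qBinomial qR j (j - 1) * (qR - 1) = qR ^ j - 1 := by
    intro j hj
    induction j with
    | zero => omega
    | succ j ih =>
      rcases Nat.eq_zero_or_pos j with rfl | hjpos
      · simp
      · have hp := qBinomial_pascal qR (show 1 ≤ j + 1 by omega) (show 1 ≤ j + 1 - 1 by omega)
        rw [show j + 1 - 1 = j by omega, show j - 1 = j - 1 from rfl, qBinomial_self] at hp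
        rw [show j + 1 - 1 = j by omega, hp, add_mul, ih hjpos, pow_succ]
        ring
  have hFq : (#F : ℝ) * (qR * qBinomial qR k (k - 1)) * (qR - 1) =
      qBinomial qR n (k - 1) * qR * (qR ^ (n - (k - 1)) - 1) := by
    have h1 : (#F : ℝ) * (qR * qBinomial qR k (k - 1)) * (qR - 1) =
        qR * qBinomial qR n k * (qBinomial qR k (k - 1) * (qR - 1)) := by rw [hFcard]; ring
    rw [h1, hgeom k (by omega)]
    linear_combination qR * hkey
  -- hence `|F| q [k choose k−1]_q ≤ 2 q^{n−k+1} [n choose k−1]_q` ... strictly less, in fact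
  have hFle : (#F : ℝ) * (qR * qBinomial qR k (k - 1)) <
      2 * qR ^ (n - k + 1) * qBinomial qR n (k - 1) := by
    have hq1 : 0 < qR - 1 := by linarith
    have hBpos : 0 < qBinomial qR n (k - 1) := lt_of_lt_of_le one_pos
      (one_le_qBinomial hq.le (by omega))
    have h1 : qBinomial qR n (k - 1) * qR * (qR ^ (n - (k - 1)) - 1) <
        2 * qR ^ (n - k + 1) * qBinomial qR n (k - 1) * (qR - 1) := by
      rw [show n - (k - 1) = n - k + 1 by omega]
      -- `q (q^j − 1) < 2 q^j (q − 1)` for `q ≥ 2`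
      have hj : qR * (qR ^ (n - k + 1) - 1) < 2 * qR ^ (n - k + 1) * (qR - 1) := by
        have hp : 0 < qR ^ (n - k + 1) := pow_pos hq _
        nlinarith
      nlinarith
    rw [← hFq] at h1
    exact lt_of_mul_lt_mul_right h1 hq1.le
  -- `1 + m(1−δ)²/q > 2^{n+3−k} = 2a`... so `|G_p| < [n choose k−1]_q q^{n−k+1} / a`
  have hGp_lt : (#Gp : ℝ) * (2 * a) < 2 * qR ^ (n - k + 1) * qBinomial qR n (k - 1) := by
    have h1 : (#Gp : ℝ) * (2 * a) ≤ #Gp * (1 + m * (1 - δ) ^ 2 / qR) :=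
      mul_le_mul_of_nonneg_left (by linarith) (Nat.cast_nonneg _)
    exact lt_of_le_of_lt (h1.trans hGp_le) hFle
  -- `|G| ≥ 2 q^{n−k+1}[n choose k−1]_q / (2a)·… : (q/2)^{n−k+1} = q^{n−k+1}/(2^{n−k+1}) = q^{n−k+1}/(a/2)`
  have hpow2 : (qR / 2) ^ (n - k + 1) * a = 2 * qR ^ (n - k + 1) := by
    rw [ha, div_pow, show n + 2 - k = n - k + 1 + 1 by omega, pow_succ (2 : ℝ) (n - k + 1)]
    field_simp
  have hGge' : 2 * qR ^ (n - k + 1) * qBinomial qR n (k - 1) ≤ #G * a := by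
    have := mul_le_mul_of_nonneg_right hGge ha0.le
    rw [mul_assoc, hpow2] at this
    linarith
  -- the rich flats: `G \ G_p ⊆` the set in question
  have hrich : #G - #Gp ≤ #((kFlats K n (k - 1)).filter fun C =>
      δ * m / qR < #(S.filter fun x => x ∈ C)) := by
    rw [← card_sdiff_of_subset (filter_subset _ G)]
    apply card_le_card
    intro C hC
    have hCG := (mem_sdiff.1 hC).1
    have hCn := (mem_sdiff.1 hC).2
    rw [mem_filter, not_and, not_le] at hCn
    have hlt := hCn hCG
    rw [hG, mem_filter] at hCG
    exact mem_filter.2 ⟨hCG.1, hlt⟩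
  have hGpG : #Gp ≤ #G := card_le_card (filter_subset _ G)
  have hcast : ((#G - #Gp : ℕ) : ℝ) = #G - #Gp := by push_cast [Nat.cast_sub hGpG]; ring
  have hfinal : (#G : ℝ) - #Gp ≤ #((kFlats K n (k - 1)).filter fun C =>
      δ * m / qR < #(S.filter fun x => x ∈ C)) := by
    rw [← hcast]; exact_mod_cast hrich
  -- combine: with `X = q^{n−k+1}[n choose k−1]_q`: `2X ≤ |G| a`, `|G_p| a < X`, so `X/a < |G| − |G_p|`
  obtain ⟨X, hX⟩ : ∃ X : ℝ, X = qR ^ (n - k + 1) * qBinomial qR n (k - 1) := ⟨_, rfl⟩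
  have hGa : 2 * X ≤ #G * a := by rw [hX]; linarith
  have hGpa : #Gp * a < X := by rw [hX]; linarith
  have h3 : X < ((#G : ℝ) - #Gp) * a := by
    have e : ((#G : ℝ) - #Gp) * a = #G * a - #Gp * a := by ring
    rw [e]; linarith
  calc a⁻¹ * qR ^ (n - k + 1) * qBinomial qR n (k - 1) = X / a := by rw [hX]; ring
    _ < #G - #Gp := by rwa [div_lt_iff₀ ha0]
    _ ≤ _ := hfinal


/-- **Theorem 2 (Dhar–Dvir–Lund), for a given Furstenberg set.** "Let `ε > 0`, let `q` be a prime
power, and let `n, k,` and `m` be integers with `2 ≤ k < n` and `m ≤ q^k`. If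
`m ≥ 2^{n+7−k} q ε^{−2}`, then `K(q, n, k, m) ≥ (1 − ε) m q^{n−k}`."  Here: every `(k, m)`-Furstenberg
`S ⊆ 𝔽_qⁿ` has `|S| ≥ (1 − ε) m q^{n−k}`.  Proof as printed: Lemma 22 with `δ = 1 − ε/4` gives
`> 2^{k−2−n} q^{n−k+1}[n choose k−1]_q` `(k−1)`-flats with more than `(1 − ε/4) m q^{−1}` points of
`S`; Lemma 23 (in the `|L| ≥ …` form) with `δ = (1 − ε/4) m q^{−k}`, `ℓ = k − 1`, `γ = 2^{k−2−n}`,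
`κ = γ q^{k−1} ≥ 2⁵ ε^{−2}`; then `κ(κ+1)⁻¹ ≥ 1 − ε/4` and — REPAIR, declared — the printed step
"`√(δ(1−δ)κ⁻¹) < √δ (ε/4)`, `> δ(1 − ε/2)`" does not follow as written (`√δ ≥ δ`); instead
`δκ = (1 − ε/4) m 2^{k−2−n} q^{−1} ≥ 24 ε^{−2}` gives `√(δ(1−δ)κ⁻¹) ≤ δ/√(δκ) ≤ δ ε/4`, whence
`|S| q^{−n} ≥ δ(1 − ε/4) − δ ε/4 = δ(1 − ε/2)` as printed, and
`(1 − ε/4)(1 − ε/2) m q^{n−k} ≥ (1 − ε) m q^{n−k}`.  (For `ε ≥ 1` the bound is trivial.)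
[cite: DharDvirLund2021FurstenbergFiniteFields, Theorem 2 (p. 3; proof p. 14)] -/
theorem sub_mul_le_card_of_isFurstenberg {k m : ℕ} (hk : 2 ≤ k) (hkn : k < n)
    (hm : m ≤ Fintype.card K ^ k) (S : Finset (Fin n → K))
    (hS : IsFurstenberg k m (S : Set (Fin n → K))) {ε : ℝ} (hε : 0 < ε)
    (hmε : (2 : ℝ) ^ (n + 7 - k) * (Fintype.card K : ℝ) / ε ^ 2 ≤ m) :
    (1 - ε) * m * (Fintype.card K : ℝ) ^ (n - k) ≤ #S := by
  set qR : ℝ := (Fintype.card K : ℝ) with hqR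
  have hq : (0 : ℝ) < qR := Nat.cast_pos.2 Fintype.card_pos
  -- trivial when `ε ≥ 1`
  rcases le_or_gt 1 ε with hε1 | hε1
  · have h1 : (1 - ε) * m * qR ^ (n - k) ≤ 0 :=
      mul_nonpos_of_nonpos_of_nonneg (mul_nonpos_of_nonpos_of_nonneg (by linarith)
        (Nat.cast_nonneg _)) (pow_pos hq _).le
    exact h1.trans (Nat.cast_nonneg _)
  -- the quantities `A = q^{k−1}`, `B = q^{n−k}`, `a = 2^{n+2−k}`
  obtain ⟨A, hA⟩ : ∃ A : ℝ, A = qR ^ (k - 1) := ⟨_, rfl⟩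
  obtain ⟨B, hB⟩ : ∃ B : ℝ, B = qR ^ (n - k) := ⟨_, rfl⟩
  obtain ⟨a, ha⟩ : ∃ a : ℝ, a = (2 : ℝ) ^ (n + 2 - k) := ⟨_, rfl⟩
  have hA0 : 0 < A := by rw [hA]; positivity
  have hB0 : 0 < B := by rw [hB]; positivity
  have ha0 : 0 < a := by rw [ha]; positivity
  have hqk : qR ^ k = A * qR := by rw [hA, ← pow_succ, Nat.sub_add_cancel (by omega)]
  have hqn : qR ^ n = B * (A * qR) := by
    rw [← hqk, hB, ← pow_add, Nat.sub_add_cancel hkn.le]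
  rw [← hB]
  -- `m ≤ A q` and `32 a q ε^{−2} ≤ m`
  have hmA : (m : ℝ) ≤ A * qR := by rw [← hqk, hqR]; exact_mod_cast hm
  have hma : 32 * a * qR / ε ^ 2 ≤ m := by
    rw [show n + 7 - k = n + 2 - k + 5 by omega, pow_add, ← ha] at hmε
    have e : a * (2 : ℝ) ^ 5 * qR / ε ^ 2 = 32 * a * qR / ε ^ 2 := by norm_num; ring
    rw [← e]; exact hmε
  have hm0 : (0 : ℝ) < m := lt_of_lt_of_le (by positivity) hma
  -- Lemma 22 with `δ = 1 − ε/4`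
  have hε0 : ε ≠ 0 := hε.ne'
  have h22 := lt_card_rich_subflats hk hkn S hS (δ := 1 - ε / 4) (by linarith) (by
    have e : (2 : ℝ) ^ (n + 3 - k) * qR / (1 - (1 - ε / 4)) ^ 2 =
        (2 : ℝ) ^ (n + 7 - k) * qR / ε ^ 2 := by
      rw [show n + 7 - k = n + 3 - k + 4 by omega, pow_add,
        show (1 - (1 - ε / 4)) ^ 2 = ε ^ 2 / 2 ^ 4 by ring]
      field_simp
    rw [e]; exact hmε)
  have hγ : (2 : ℝ) ^ ((k : ℤ) - 2 - n) = a⁻¹ := by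
    rw [ha, ← zpow_natCast, ← zpow_neg]
    congr 1
    push_cast [Nat.cast_sub (show k ≤ n + 2 by omega)]
    ring
  rw [hγ] at h22
  -- Lemma 23 with `δ₂ = (1 − ε/4) m/(A q)`, `γ = a⁻¹`, `ℓ = k − 1`
  obtain ⟨δ₂, hδ₂⟩ : ∃ δ₂ : ℝ, δ₂ = (1 - ε / 4) * m / (A * qR) := ⟨_, rfl⟩
  have hε4 : 0 < 1 - ε / 4 := by linarith
  have hδ₂0 : 0 < δ₂ := by rw [hδ₂]; positivity
  have hδ₂1 : δ₂ ≤ 1 := by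
    rw [hδ₂, div_le_one (by positivity)]
    calc (1 - ε / 4) * m ≤ 1 * m := mul_le_mul_of_nonneg_right (by linarith) hm0.le
      _ ≤ A * qR := by rw [one_mul]; exact hmA
  have h23 := sub_sqrt_mul_pow_le_card_of_le (K := K) (ℓ := k - 1) (by omega) (by omega) S hδ₂0
    (inv_pos.2 ha0) (filter_subset _ _) (L := (kFlats K n (k - 1)).filter fun C =>
      (1 - ε / 4) * m / qR < #(S.filter fun x => x ∈ C))
    (fun C hC => by
      have h1 := (mem_filter.1 hC).2
      have e : δ₂ * qR ^ (k - 1) = (1 - ε / 4) * m / qR := by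
        rw [hδ₂, ← hA]; field_simp
      rw [e]; exact h1.le)
    (by rw [show n - (k - 1) = n - k + 1 by omega]; exact h22.le)
  rw [← hA] at h23
  obtain ⟨κ, hκ⟩ : ∃ κ : ℝ, κ = a⁻¹ * A := ⟨_, rfl⟩
  rw [← hκ] at h23
  have hκ0 : 0 < κ := by rw [hκ]; positivity
  -- `κ ≥ 32 ε^{−2} ≥ 4/ε` and `δ₂ κ ≥ 24 ε^{−2}`
  have hκε : 4 ≤ κ * ε := by
    -- `A ≥ 32 a/ε²` from `32 a q/ε² ≤ m ≤ A q`
    have h1 : 32 * a / ε ^ 2 ≤ A := by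
      have h2 : 32 * a * qR / ε ^ 2 ≤ A * qR := hma.trans hmA
      rw [div_le_iff₀ (by positivity)] at h2 ⊢
      nlinarith
    rw [hκ]
    rw [div_le_iff₀ (by positivity)] at h1
    -- `a⁻¹ A ε² ≥ 32`, so `a⁻¹ A ε ≥ 32/ε ≥ 32 ≥ 4` as `ε < 1`
    have h3 : 32 ≤ a⁻¹ * A * ε ^ 2 := by
      have : a⁻¹ * A * ε ^ 2 = A * ε ^ 2 / a := by ring
      rw [this, le_div_iff₀ ha0]; linarith
    have h4 : a⁻¹ * A * ε ^ 2 = (a⁻¹ * A * ε) * ε := by ring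
    have h5 : (a⁻¹ * A * ε) * ε ≤ (a⁻¹ * A * ε) * 1 :=
      mul_le_mul_of_nonneg_left hε1.le (by positivity)
    linarith
  have hδκ : 16 ≤ δ₂ * κ * ε ^ 2 := by
    have e : δ₂ * κ * ε ^ 2 = (1 - ε / 4) * (m * ε ^ 2 / (a * qR)) := by
      rw [hδ₂, hκ]; field_simp
    have h1 : 32 ≤ (m : ℝ) * ε ^ 2 / (a * qR) := by
      rw [le_div_iff₀ (by positivity)]
      rw [div_le_iff₀ (by positivity)] at hma
      linarith
    have h2 := mul_le_mul (show (3 : ℝ) / 4 ≤ 1 - ε / 4 by linarith) h1 (by norm_num) hε4.le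
    rw [e]; linarith
  -- the two estimates
  obtain ⟨D, hD⟩ : ∃ D : ℝ, D = δ₂ * qR ^ n := ⟨_, rfl⟩
  have hDm : D = (1 - ε / 4) * m * B := by rw [hD, hδ₂, hqn]; field_simp
  have hD0 : 0 ≤ D := by rw [hD]; positivity
  have hT1 : D * (1 - ε / 4) ≤ δ₂ * κ * (κ + 1)⁻¹ * qR ^ n := by
    have h1 : 1 - ε / 4 ≤ κ * (κ + 1)⁻¹ := by
      rw [← div_eq_mul_inv, le_div_iff₀ (by linarith)]
      have e : (1 - ε / 4) * (κ + 1) = κ + 1 - κ * ε / 4 - ε / 4 := by ring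
      rw [e]; linarith
    calc D * (1 - ε / 4) ≤ D * (κ * (κ + 1)⁻¹) := mul_le_mul_of_nonneg_left h1 hD0
      _ = δ₂ * κ * (κ + 1)⁻¹ * qR ^ n := by rw [hD]; ring
  have hT2 : Real.sqrt (δ₂ * (1 - δ₂) * κ⁻¹) * qR ^ n ≤ D * (ε / 4) := by
    have h1 : Real.sqrt (δ₂ * (1 - δ₂) * κ⁻¹) ≤ δ₂ * (ε / 4) := by
      rw [show δ₂ * (ε / 4) = Real.sqrt ((δ₂ * (ε / 4)) ^ 2) by
        rw [Real.sqrt_sq (by positivity)]]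
      apply Real.sqrt_le_sqrt
      have h2 : δ₂ * (1 - δ₂) * κ⁻¹ ≤ δ₂ * κ⁻¹ := by
        have h0 : 0 ≤ δ₂ * δ₂ * κ⁻¹ := by positivity
        have e : δ₂ * (1 - δ₂) * κ⁻¹ = δ₂ * κ⁻¹ - δ₂ * δ₂ * κ⁻¹ := by ring
        rw [e]; linarith
      have h3 : δ₂ * κ⁻¹ ≤ (δ₂ * (ε / 4)) ^ 2 := by
        -- `16 δ₂ ≤ δ₂² ε² κ`
        rw [show δ₂ * κ⁻¹ = δ₂ / κ by ring, div_le_iff₀ hκ0]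
        have h4 := mul_le_mul_of_nonneg_left hδκ hδ₂0.le
        have e2 : (δ₂ * (ε / 4)) ^ 2 * κ = δ₂ * (δ₂ * κ * ε ^ 2) / 16 := by ring
        rw [e2, le_div_iff₀ (by norm_num)]
        linarith
      exact h2.trans h3
    calc Real.sqrt (δ₂ * (1 - δ₂) * κ⁻¹) * qR ^ n ≤ δ₂ * (ε / 4) * qR ^ n :=
          mul_le_mul_of_nonneg_right h1 (pow_pos hq _).le
      _ = D * (ε / 4) := by rw [hD]; ring
  have hfin : (1 - ε) * m * B ≤ D * (1 - ε / 4) - D * (ε / 4) := by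
    have e : D * (1 - ε / 4) - D * (ε / 4) - (1 - ε) * m * B = m * B * (ε / 4 + ε ^ 2 / 8) := by
      rw [hDm]; ring
    have h0 : 0 ≤ (m : ℝ) * B * (ε / 4 + ε ^ 2 / 8) := by positivity
    linarith
  calc (1 - ε) * m * B ≤ D * (1 - ε / 4) - D * (ε / 4) := hfin
    _ ≤ (δ₂ * κ * (κ + 1)⁻¹ - Real.sqrt (δ₂ * (1 - δ₂) * κ⁻¹)) * qR ^ n := by
        rw [sub_mul]; linarith
    _ ≤ #S := h23

/-- **Theorem 2, exactly as printed**: for `2 ≤ k < n`, `m ≤ q^k`, `ε > 0` and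
`m ≥ 2^{n+7−k} q ε^{−2}`, `K(q, n, k, m) ≥ (1 − ε) m q^{n−k}`.
[cite: DharDvirLund2021FurstenbergFiniteFields, Theorem 2 (p. 3)] -/
theorem sub_mul_le_furstenbergNumber {k m : ℕ} (hk : 2 ≤ k) (hkn : k < n)
    (hm : m ≤ Fintype.card K ^ k) {ε : ℝ} (hε : 0 < ε)
    (hmε : (2 : ℝ) ^ (n + 7 - k) * (Fintype.card K : ℝ) / ε ^ 2 ≤ m) :
    (1 - ε) * m * (Fintype.card K : ℝ) ^ (n - k) ≤ (furstenbergNumber K n k m : ℝ) := by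
  obtain ⟨S, hS, hF⟩ := exists_card_eq_furstenbergNumber (K := K) hkn.le hm
  rw [← hS]
  exact sub_mul_le_card_of_isFurstenberg hk hkn hm S hF hε hmε

end LargeM

/-! ### Hyperplanes and lines: Vinh's Szemerédi–Trotter type bound over finite fields -/

section Hyperplanes

variable {n : ℕ} [Fintype K] [DecidableEq K]

/-- **Incidences of points and hyperplanes** (Lemma 5 with `k = n − 1`, where
`[n−1 choose n−1]_q = 1` and both correction factors are at most `1`): for a set `P` of points and
a set `H` of hyperplanes (`(n−1)`-flats) of `𝔽_qⁿ`, `n ≥ 2`,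
`I(P, H) ≤ |P||H|/q + q^{(n−1)/2} √(|P||H|)`.  This is Vinh's Theorem 5 ("Let `P` be a collection
of points in `𝔽_q^d` and `H` be a collection of hyperplanes in `𝔽_q^d` with `d ≥ 2`. Then
`|{(p, h) ∈ P × H : p ∈ h}| ≤ |P||H|/q + q^{(d−1)/2}(1 + o(1)) √(|P||H|)`"), with the factor
`1 + o(1)` replaced by `1`. [cite: Vinh2011, Theorem 5] -/
theorem incidences_hyperplanes_le (hn : 2 ≤ n) (P : Finset (Fin n → K))
    {H : Finset (Finset (Fin n → K))} (hH : H ⊆ kFlats K n (n - 1)) :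
    (incidences P H : ℝ) ≤ #P * #H / (Fintype.card K : ℝ) +
      Real.sqrt (Fintype.card K : ℝ) ^ (n - 1) * Real.sqrt (#P * #H) := by
  set qR : ℝ := (Fintype.card K : ℝ) with hqR
  have hq : (0 : ℝ) < qR := Nat.cast_pos.2 Fintype.card_pos
  have hsq := sq_incidences_sub_le (K := K) (k := n - 1) (by omega) (Nat.sub_le n 1) P hH
  have hB1 : 1 ≤ qBinomial qR n (n - 1) := one_le_qBinomial hq.le (Nat.sub_le n 1)
  rw [qBinomial_self] at hsq
  -- the mean term `q^{n−1}/qⁿ = 1/q`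
  have hmean : qR ^ (n - 1) / qR ^ n * #P * #H = #P * #H / qR := by
    have hqn : qR ^ n = qR ^ (n - 1) * qR := by rw [← pow_succ, Nat.sub_add_cancel (by omega)]
    obtain ⟨a, ha⟩ : ∃ a : ℝ, a = qR ^ (n - 1) := ⟨_, rfl⟩
    have ha0 : 0 < a := by rw [ha]; positivity
    rw [hqn, ← ha, div_mul_eq_mul_div, div_mul_eq_mul_div, mul_comm a qR,
      div_eq_div_iff (mul_ne_zero hq.ne' ha0.ne') hq.ne']
    ring
  rw [hmean] at hsq
  -- drop the two correction factors
  have hb : (#H : ℝ) ≤ qR ^ (n - (n - 1)) * qBinomial qR n (n - 1) := by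
    rw [← card_kFlats_eq (by omega) (Nat.sub_le n 1)]; exact_mod_cast card_le_card hH
  have hP1 : (#P : ℝ) * (1 - #P / qR ^ n) ≤ #P := by
    have : 0 ≤ (#P : ℝ) / qR ^ n := by positivity
    nlinarith
  have hH1 : (#H : ℝ) * (1 - #H / (qR ^ (n - (n - 1)) * qBinomial qR n (n - 1))) ≤ #H := by
    have : 0 ≤ (#H : ℝ) / (qR ^ (n - (n - 1)) * qBinomial qR n (n - 1)) := by
      apply div_nonneg (Nat.cast_nonneg _); exact mul_nonneg (pow_pos hq _).le (by linarith)
    nlinarith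
  have hH0 : 0 ≤ (#H : ℝ) * (1 - #H / (qR ^ (n - (n - 1)) * qBinomial qR n (n - 1))) := by
    apply mul_nonneg (Nat.cast_nonneg _)
    rw [sub_nonneg, div_le_one (mul_pos (pow_pos hq _) (by linarith))]; exact hb
  have hup : qR ^ (n - 1) * 1 * (#P * (1 - #P / qR ^ n)) *
      (#H * (1 - #H / (qR ^ (n - (n - 1)) * qBinomial qR n (n - 1)))) ≤
      qR ^ (n - 1) * (#P * #H) := by
    calc qR ^ (n - 1) * 1 * (#P * (1 - #P / qR ^ n)) *
        (#H * (1 - #H / (qR ^ (n - (n - 1)) * qBinomial qR n (n - 1))))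
        ≤ qR ^ (n - 1) * 1 * #P * #H := by
          have h1 : qR ^ (n - 1) * 1 * (#P * (1 - #P / qR ^ n)) ≤ qR ^ (n - 1) * 1 * #P :=
            mul_le_mul_of_nonneg_left hP1 (by positivity)
          calc _ ≤ qR ^ (n - 1) * 1 * #P *
              (#H * (1 - #H / (qR ^ (n - (n - 1)) * qBinomial qR n (n - 1)))) :=
                mul_le_mul_of_nonneg_right h1 hH0
            _ ≤ qR ^ (n - 1) * 1 * #P * #H := mul_le_mul_of_nonneg_left hH1 (by positivity)
      _ = qR ^ (n - 1) * (#P * #H) := by ring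
  have h := Real.abs_le_sqrt (hsq.trans hup)
  have h' := (le_abs_self _).trans h
  rw [Real.sqrt_mul (pow_pos hq _).le, Real.sqrt_eq_rpow, ← Real.rpow_natCast,
    ← Real.rpow_mul hq.le] at h'
  rw [Real.sqrt_eq_rpow qR, ← Real.rpow_natCast (qR ^ (1/2 : ℝ)), ← Real.rpow_mul hq.le,
    mul_comm (1/2 : ℝ)]
  linarith

/-- **Vinh's Szemerédi–Trotter type theorem over finite fields (Theorem 3), exactly as printed:**
"Let `P` be a collection of points and `L` be a collection of lines in `𝔽_q²`. Then we have
`|{(p, l) ∈ P × L : p ∈ l}| ≤ |P||L|/q + q^{1/2} √(|P||L|)`."  (Vinh proves it from the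
eigenvalues of the Erdős–Rényi orthogonality graph of `PG(2, q)`; here it is the case `n = 2` of
`incidences_hyperplanes_le`, i.e. Haemers' bound for the `2-(q², q, 1)` design of lines.)
[cite: Vinh2011, Theorem 3] -/
theorem incidences_lines_le (P : Finset (Fin 2 → K)) {L : Finset (Finset (Fin 2 → K))}
    (hL : L ⊆ kFlats K 2 1) :
    (#((P ×ˢ L).filter fun p => p.1 ∈ p.2) : ℝ) ≤ #P * #L / (Fintype.card K : ℝ) +
      (Fintype.card K : ℝ) ^ (1 / 2 : ℝ) * Real.sqrt (#P * #L) := by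
  have h := incidences_hyperplanes_le (K := K) (n := 2) le_rfl P hL
  rw [pow_one, Real.sqrt_eq_rpow] at h
  exact h

end Hyperplanes

end Furstenberg

end Literature.Combinatorics.Kakeya
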